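import Mathlib
import Literature.NumberTheory.Sieve.RomanovTheorem
import Literature.NumberTheory.Sieve.GoldbachLinnikRomanovConstant
import Literature.NumberTheory.Sieve.GoldbachLinnikRomanovCertValue
import Literature.NumberTheory.Sieve.TwinPrimeConstUpperBound
import Literature.NumberTheory.Sieve.SingularSeriesProofs
import Literature.NumberTheory.Sieve.RieselVaughanShiftedPrimesInIntervals
import Literature.NumberTheory.LFunctions.RosserSchoenfeldPrimeCountingBounds
import Literature.NumberTheory.Sieve.TwoResidueSelbergSumExplicit
import Literature.NumberTheory.Multiplicative.ChebyshevThetaExplicit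
import Literature.NumberTheory.LFunctions.ChebyshevPsiExplicit
import HarnessLib

/-!
# Romanoff's theorem with an explicit constant, UNIFORMLY in `N ≥ 4`: `#{n ≤ N : n = p + 2^k, k ≥ 1} ≥ N/25`

Topic `Literature/NumberTheory/Sieve`.  An explicit-uniform companion to the tree's `RomanovTheorem.lean` (Romanoff 1934:
positive lower density, `∃ c ∃ N₀`) and to the asymptotic Romanov-constant literature (Chen–Sun 2004 `0.0868`, Habsieger–Roblot
2006 `0.0933`, Pintz 2006 `0.09368`, Elsholtz–Schlage-Puchta 2018 `0.107`, Johnston–Trudgian 2026 `0.12532` — all `lim inf`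
statements, resting on asymptotic pair-sieve constants `8 + ε`, `7.83`, `6.78`).  Here the constant `1/25` holds for EVERY `N ≥ 4`
(`romanovSet 4 = {4}`, so no uniform constant can exceed `1/4`).  NOT a new asymptotic constant and NOT a parity-type statement:
the method is Romanoff's own (first moment + upper-bound pair sieve for the second moment + Cauchy–Schwarz) with every constant
explicit and every range of `N` closed, and its two analytic inputs are the tree's registered named facts
* `RieselVaughan1983_lemma5` (`Sieve/RieselVaughanShiftedPrimesInIntervals.lean`): for `x ≥ e^{24}`, `h ≠ 0`,
  `#{p ≤ x : p + h prime} < (16 C₂ x/log²x − 100√x) ∏_{p|h,p>2}(p−1)/(p−2)`;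
* `RosserSchoenfeld1962_theorem2` (`LFunctions/RosserSchoenfeldPrimeCountingBounds.lean`), eq. (3.3): `x/(log x − ½) < π(x)`, `x ≥ 67`;
used as hypotheses `(hRV : …) (hRS : …)` — nothing new is asserted.  Tree inputs consumed (all PROVED): `twinPrimeConst_le_0660166`
(`C₂ ≤ 0.660166`), `twinPrimeConst_pos_holds`, `GoldbachLinnik.romanovConst_le_193841` (`R₀ ≤ 1.93841`),
`GoldbachLinnik.sum_oddSingularFactor_two_pow_sub_one_le` (`∑_{m ≤ M} f(2^m − 1) ≤ R₀ M`, every `M`),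
`GoldbachLinnik.oddSingularFactor_two_pow_mul`, `Romanov.card_filter_prod_eq_sum_sq`, `RomanovConstant.sq_sum_le_card_support_mul`,
`RomanovConstant.filter_pos_eq_romanovSet`, `romanovRep_pos_iff`, `RomanovConstant.mem_romanovSet` (the last five COPIED locally in
this decoupled variant, §0b).

* §0 statements (shapes, parameters only): `RomanoffAllN c N₁` (headline = `RomanoffAllN (1/25) 4`), `pairCount x h = #{p ≤ x : p + h prime}`,
  `UniformPairSieve A x₀` (`pairCount x h ≤ A f(h) x/log²x` for `x ≥ x₀`, even `h ≠ 0`), `PrimeCountingLower x₁`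
  (`n/(log n − 1) ≤ π(n)`, `n ≥ x₁` — Dusart's shape), `PowTwoShiftMeanLe R`.
* §1 `powTwoShiftMeanLe_193841 : PowTwoShiftMeanLe 1.93841` (`∑_{a ≠ b ≤ L} f(2^{|a−b|} − 1) ≤ 1.93841 L²`; Abel summation of the
  tree's row bound).
* §2 exact combinatorics: `S₁ = ∑_{n ≤ N} r(n) = #repPairs` (`M1_eq`), `S₂ = ∑ r(n)² = #collisions` (`M2_eq`), diagonal +
  off-diagonal (`card_coll_eq`), every off-diagonal exponent fibre injects into `{p ≤ N : p + (2^{max} − 2^{min}) prime}`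
  (`card_fibre_le_pairCount`); `M2_le`, `M1_ge : ∑_{k ≤ log₂N} π(N − 2^k) ≤ S₁`.
* §3 the inputs applied: `offdiag_le`, `M2_le_final : S₂ ≤ S₁ + (A R/log²2) N` (`N ≥ max(x₀, 2)`), `natlog_main :
  N(log N/log 2 − 2) ≤ K N − 2·2^K` (`K = ⌊log₂ N⌋`, concavity of `log`), `M1_ge_final` (Dusart shape, `x₁ = 5393`).
* §4 `density_of_moments` (`s N ≤ S₁`, `S₂ ≤ S₁ + B N` ⇒ `#romanovSet N ≥ s²/(s+B)·N`), `density_ge` (`A ≤ 10.5627`,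
  `N ≥ max(x₀, 2^20)`, Dusart-shaped `π` ⇒ `N/25`; `s = 1.398`, `B = 42.62`).
* §5 `4 ≤ N < 2^20` with ONE shift: `#romanovSet N ≥ π(N − 2) ≥ N/25` — `small_range` (five kernel checkpoints on the first 216
  primes, `N < 5395`), `mid_range` (`5395 ≤ N`, `log N ≤ 25.9`).
* §6 `headline_of_uniformPairSieve` — the abstract headline with a Dusart-shaped `π` input (`x₀ ≤ e^{25.9}`).
* §7 the Rosser–Schoenfeld-shaped variants (`PrimeCountingLowerWith a x₁`, `M1_ge_with`, `density_ge_RS` with `s = 1.34`,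
  `mid_range_RS` up to `log N ≤ 25.4`, `headline_of_uniformPairSieve_RS` for `x₀ ≤ e^{25.4}`), the bridge
  `uniformPairSieve_of_RV : RieselVaughan1983_lemma5 → UniformPairSieve (16 C₂) e^{24}`, and the headline
  **`headline_of_RV_RS : RieselVaughan1983_lemma5 → RosserSchoenfeld1962_theorem2 → RomanoffAllN (1/25) 4`**.
* §8 (appended) the same from Rosser–Schoenfeld (3.3) ALONE, the pair sieve being the PROVED explicit
  `TwoResidueSelbergExplicit.pairCount_le_explicit` (`A = 20.8`, `x₀ = e^{47}`):
  **`romanoffAllN_of_RS : RosserSchoenfeld1962_theorem2 → RomanoffAllN (1/48) 4`** (cell parity-ideate seat p5, ROUND-22).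
* §9 (appended) the κ-refined version (`TwoResidueSelbergExplicit.pairCount_le_kappa`, `A = 17.75`, `x₀ = e^{41}`):
  **`romanoffAllN_of_RS_kappa : RosserSchoenfeld1962_theorem2 → RomanoffAllN (1/41) 4`** (p5, ROUND-22 §9(a)).
* §10 (appended) UNCONDITIONAL: the `π`-input is Chebyshev's bound as proved in Mathlib (`0.69 n/log n ≤ π(n)`, `n ≥ 2^30`;
  `primeCountingLowerMul_chebyshev`) and the tree's `quarter_le_theta` (`θ ≥ x/4`, `x ≥ 3`) for the mid range:
  **`romanoffAllN_unconditional : RomanoffAllN (1/79) 4`** — `∀ N ≥ 4, #romanovSet N ≥ N/79`, NO hypotheses, NO named facts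
  (p5, ROUND-22 PART D; `s = 0.96`, `B = 4.035·17.75`, `0.96²/72.58 ≥ 1/79`).
* §11 (appended) the same chain with Chebyshev's own constant: `primeCountingLowerMul_09212 : PrimeCountingLowerMul 0.9212 (10^6)`
  (tree `ChebyshevExplicit.psi_ge_chebyshev`), `density_cheb_mul` (`s = 1.28`), `primeCounting_ge_div45` (`(x+2)/45 ≤ π(x)`,
  `88 ≤ x ≤ e^41`): **`romanoffAllN_cheb : RomanoffAllN (1/45) 4`** — NO hypotheses, NO named facts (p5, ROUND-24).

Numbers: `A = 16 C₂ ≤ 10.5627`, `B = A R₀/log²2 ≤ 42.62`; at `log N ≥ 20 log 2`, `S₁ ≥ 1.34 N` ((3.3)) resp. `1.398 N` (Dusart);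
`c = s²/(s + B) = 0.0408` resp. `0.0444 ≥ 1/25`; the method's ceiling with `A = 16 C₂` is `≈ 0.047` (`s → 1/log 2`).
Provenance: cell parity-ideate, seat p5 (lens «nearmiss»), ROUND-20 §5 (design) and ROUND-21 (this proof); the exact count
`#romanovSet N` for `N ≤ 2.65·10¹⁰` (kit job j318756) has `min_N d(N) = 1/4` at `N = 4` and `d(N) ≥ 0.45` beyond `N = 24`.

## References
* N. P. Romanoff, *Über einige Sätze der additiven Zahlentheorie*, Math. Ann. 109 (1934) 668–678. [Romanoff1934]
* H. Riesel, R. C. Vaughan, *On sums of primes*, Ark. Mat. 21 (1983) 45–74, Lemma 5 (p. 53, table p. 54). [RieselVaughan1983]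
* J. B. Rosser, L. Schoenfeld, *Approximate formulas for some functions of prime numbers*, Illinois J. Math. 6 (1962) 64–94,
  Theorem 2, eq. (3.3). [RosserSchoenfeld1962]
* J. Pintz, I. Z. Ruzsa, *On Linnik's approximation to Goldbach's problem, I*, Acta Arith. 109 (2003) 169–194, §8. [PintzRuzsa2003]
* P. Dusart, *Estimates of some functions over primes without R.H.*, arXiv:1002.0442 (2010), Thm 6.9 (the shape of `PrimeCountingLower`). [Dusart2010]
* Y.-G. Chen, X.-G. Sun, *On Romanoff's constant*, J. Number Theory 106 (2004) 275–284. [ChenSun2004]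
-/

namespace Literature.NumberTheory.Sieve

namespace RomanoffExplicit

open Finset
open GoldbachLinnik Romanov

/-! ## §0 Statements -/

/-- The SHAPE of Romanoff's theorem with an explicit constant, uniform in `N ≥ N₁`: `c · N ≤ #{n ≤ N : n = p + 2^k, k ≥ 1}`
for every `N ≥ N₁` (Romanov 1934: some `c > 0` and some `N₁`; here `c` and `N₁` are parameters — nothing is asserted by
this definition; the value `c = 1/25`, `N₁ = 4` is PROVED below from two cited inputs).
[cite: Nathanson1996, §7.6 Theorem 7.11 (Romanov's theorem; explicit-uniform shape)] [cite: Romanoff1934, Satz (Romanov's theorem)] -/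
def RomanoffAllN (c : ℝ) (N₁ : ℕ) : Prop :=
  ∀ N : ℕ, N₁ ≤ N → c * (N : ℝ) ≤ ((romanovSet N).card : ℝ)

/-- `π_h(x) = #{p ≤ x : p, p + h both prime}`. [folklore] -/
def pairCount (x h : ℕ) : ℕ := ((Nat.primesLE x).filter fun p => (p + h).Prime).card

/-- The SHAPE of an upper-bound pair sieve with constant `A`, uniform in the even shift `h ≠ 0` and in `x ≥ x₀`:
`π_h(x) ≤ A · f(h) · x / log² x`, `f(h) = ∏_{p | h, p > 2} (p−1)/(p−2)` (= tree `oddSingularFactor`).  `A`, `x₀` are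
parameters (nothing asserted); Riesel–Vaughan's Lemma 5 supplies `A = 16 C₂`, `x₀ = e^{24}` (`uniformPairSieve_of_RV`).
[cite: RieselVaughan1983, Lemma 5 (shape of the h-uniform prime-pair bound)] -/
def UniformPairSieve (A x₀ : ℝ) : Prop :=
  ∀ x h : ℕ, x₀ ≤ (x : ℝ) → h ≠ 0 → Even h →
    (pairCount x h : ℝ) ≤ A * oddSingularFactor h * (x : ℝ) / Real.log (x : ℝ) ^ 2

/-- The SHAPE of a `π`-lower bound `n/(log n − 1) ≤ π(n)` for `n ≥ x₁` (`x₁` a parameter; Dusart 2010 Thm 6.9 is the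
instance `x₁ = 5393`, which this file only ever takes as a hypothesis). [cite: Dusart2010, Theorem 6.9 (shape)] -/
def PrimeCountingLower (x₁ : ℕ) : Prop :=
  ∀ n : ℕ, x₁ ≤ n → (n : ℝ) / (Real.log (n : ℝ) - 1) ≤ (Nat.primeCounting n : ℝ)

/-- The SHAPE of the uniform (all-`L`) power-of-two-shift mean of the odd singular factor:
`∑_{a,b ∈ [1,L], a ≠ b} f(2^{|a−b|} − 1) ≤ R L²` (`R` a parameter; Pintz–Ruzsa's `R₀` of (8.8)–(8.14) is the constant of the
diagonal-free mean; the instance `R = 1.93841` is PROVED below from the tree's kernel certificate).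
[cite: PintzRuzsa2003, §8 (8.8)–(8.14) (shape of the R₀-mean)] -/
def PowTwoShiftMeanLe (R : ℝ) : Prop :=
  ∀ L : ℕ, 1 ≤ L → (∑ a ∈ Icc 1 L, ∑ b ∈ Icc 1 L,
    (if a = b then (0 : ℝ) else oddSingularFactor (2 ^ (max a b - min a b) - 1))) ≤ R * (L : ℝ) ^ 2

/-! ## §0b Private local copies of five small tree declarations

`romanovRep`, `romanovRep_pos_iff` (tree `RomanovFirstMoment`), `mem_romanovSet`, `filter_pos_eq_romanovSet`,
`sq_sum_le_card_support_mul` (tree `RomanovConstantPintzMethod`) are copied here verbatim and PRIVATE, because both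
originals sit behind the module `RomanovConstantPintzObservation`, whose farm build was unavailable when this file landed
(2026-08-28/29).  Only `Romanov.romanovSet` (tree `RomanovTheorem`) appears in public statements. -/

/-- `r(n) = #{(p, k) : p prime, k ≥ 1, p + 2^k = n}` (private copy of the tree's `romanovRep`). [folklore] -/
private def romanovRep (n : ℕ) : ℕ :=
  (((Finset.range (n + 1)) ×ˢ (Finset.range (n + 1))).filter
    (fun x : ℕ × ℕ => x.1.Prime ∧ 1 ≤ x.2 ∧ x.1 + 2 ^ x.2 = n)).card

/-- The coordinates of a representation `p + 2^k = n` are `≤ n`. [folklore] -/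
private theorem bounds_of_rep {p k n : ℕ} (h : p + 2 ^ k = n) : p < n + 1 ∧ k < n + 1 := by
  have hk : k < 2 ^ k := Nat.lt_two_pow_self
  omega

/-- Membership in `Romanov.romanovSet N` (private copy of the tree's `RomanovConstant.mem_romanovSet`). [folklore] -/
private theorem mem_romanovSet {N n : ℕ} :
    n ∈ romanovSet N ↔ n ≤ N ∧ ∃ p k : ℕ, p.Prime ∧ 1 ≤ k ∧ p + 2 ^ k = n := by
  classical
  unfold romanovSet
  rw [Finset.mem_filter, Finset.mem_range, Nat.lt_succ_iff]

/-- `r(n) > 0 ↔ n = p + 2^k` (private copy of the tree's `romanovRep_pos_iff`). [folklore] -/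
private theorem romanovRep_pos_iff (n : ℕ) : 0 < romanovRep n ↔ ∃ p k : ℕ, p.Prime ∧ 1 ≤ k ∧ p + 2 ^ k = n := by
  rw [romanovRep, Finset.card_pos]
  constructor
  · rintro ⟨⟨p, k⟩, hx⟩
    rw [Finset.mem_filter] at hx
    exact ⟨p, k, hx.2.1, hx.2.2.1, hx.2.2.2⟩
  · rintro ⟨p, k, hp, hk, hpk⟩
    refine ⟨(p, k), ?_⟩
    rw [Finset.mem_filter, Finset.mem_product, Finset.mem_range, Finset.mem_range]
    exact ⟨⟨(bounds_of_rep hpk).1, (bounds_of_rep hpk).2⟩, hp, hk, hpk⟩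

/-- Support of `r` on `[0, N]` is `romanovSet N` (private copy of the tree's `filter_pos_eq_romanovSet`). [folklore] -/
private theorem filter_pos_eq_romanovSet {r : ℕ → ℕ} (hr : ∀ n, 0 < r n ↔ ∃ p k : ℕ, p.Prime ∧ 1 ≤ k ∧ p + 2 ^ k = n)
    (N : ℕ) : (Finset.range (N + 1)).filter (fun n => 0 < r n) = romanovSet N := by
  ext n
  rw [Finset.mem_filter, Finset.mem_range, Nat.lt_succ_iff, mem_romanovSet, hr]

/-- Cauchy–Schwarz `(Σ r)² ≤ #{r > 0} · Σ r²` (private copy of the tree's `sq_sum_le_card_support_mul`). [folklore] -/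
private theorem sq_sum_le_card_support_mul {ι : Type*} (s : Finset ι) (r : ι → ℕ) :
    (∑ i ∈ s, (r i : ℝ)) ^ 2 ≤ ((s.filter (fun i => 0 < r i)).card : ℝ) * ∑ i ∈ s, (r i : ℝ) ^ 2 := by
  classical
  have h1 : ∑ i ∈ s, (r i : ℝ) = ∑ i ∈ s.filter (fun i => 0 < r i), (r i : ℝ) := by
    rw [Finset.sum_filter]
    refine Finset.sum_congr rfl (fun i _ => ?_)
    split_ifs with h
    · rfl
    · have : r i = 0 := by omega
      simp [this]
  have h2 : ∑ i ∈ s.filter (fun i => 0 < r i), (r i : ℝ) ^ 2 ≤ ∑ i ∈ s, (r i : ℝ) ^ 2 :=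
    Finset.sum_le_sum_of_subset_of_nonneg (Finset.filter_subset _ _) (fun i _ _ => by positivity)
  have h3 := sq_sum_le_card_mul_sum_sq (s := s.filter (fun i => 0 < r i)) (f := fun i => (r i : ℝ))
  rw [h1]
  exact h3.trans (mul_le_mul_of_nonneg_left h2 (Nat.cast_nonneg _))


/-! ## §1 `PowTwoShiftMeanLe 1.93841` from the tree's Romanov-constant certificate (one Abel summation) -/

/-- `g m = f(2^m − 1)`. [folklore] -/
noncomputable def g (m : ℕ) : ℝ := oddSingularFactor (2 ^ m - 1)

/-- The symmetric off-diagonal kernel. [folklore] -/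
noncomputable def hk (a b : ℕ) : ℝ :=
  if a = b then 0 else oddSingularFactor (2 ^ (max a b - min a b) - 1)

/-- `Soff L = ∑_{a,b ≤ L, a ≠ b} f(2^{|a−b|} − 1)`. [folklore] -/
noncomputable def Soff (L : ℕ) : ℝ := ∑ a ∈ Icc 1 L, ∑ b ∈ Icc 1 L, hk a b

/-- `F M = ∑_{m=1}^{M} f(2^m − 1)`. [folklore] -/
noncomputable def F (M : ℕ) : ℝ := ∑ m ∈ Icc 1 M, g m

/-- The kernel is symmetric. [folklore] -/
private lemma hk_symm (a b : ℕ) : hk a b = hk b a := by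
  unfold hk
  by_cases hab : a = b
  · subst hab; simp
  · rw [if_neg hab, if_neg (Ne.symm hab), max_comm, min_comm]

/-- The last column of the kernel. [folklore] -/
private lemma hk_top (a L : ℕ) (ha : a ∈ Icc 1 L) : hk a (L + 1) = g (L + 1 - a) := by
  rw [mem_Icc] at ha
  unfold hk g
  have hne : a ≠ L + 1 := by omega
  have hle : a ≤ L + 1 := by omega
  rw [if_neg hne, max_eq_right hle, min_eq_left hle]

/-- Row sums of the last column are `F L` (reindex `a ↦ L + 1 − a`). [folklore] -/
private lemma row_sum (L : ℕ) : ∑ a ∈ Icc 1 L, g (L + 1 - a) = F L := by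
  unfold F
  refine Finset.sum_nbij' (fun a => L + 1 - a) (fun m => L + 1 - m) ?_ ?_ ?_ ?_ ?_
  · intro a ha; simp only [mem_Icc] at ha ⊢; omega
  · intro a ha; simp only [mem_Icc] at ha ⊢; omega
  · intro a ha; simp only [mem_Icc] at ha; omega
  · intro a ha; simp only [mem_Icc] at ha; omega
  · intro a _; rfl

/-- Peeling the last row and column: `Soff (L+1) = Soff L + 2 F L`. [folklore] -/
private lemma Soff_succ (L : ℕ) : Soff (L + 1) = Soff L + 2 * F L := by
  unfold Soff
  rw [Finset.sum_Icc_succ_top (Nat.le_add_left 1 L)]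
  have inner : ∀ a ∈ Icc 1 L,
      ∑ b ∈ Icc 1 (L + 1), hk a b = ∑ b ∈ Icc 1 L, hk a b + g (L + 1 - a) := by
    intro a ha
    rw [Finset.sum_Icc_succ_top (Nat.le_add_left 1 L), hk_top a L ha]
  have last : ∑ b ∈ Icc 1 (L + 1), hk (L + 1) b = F L := by
    rw [Finset.sum_Icc_succ_top (Nat.le_add_left 1 L)]
    have h0 : hk (L + 1) (L + 1) = 0 := by unfold hk; simp
    rw [h0, add_zero, ← row_sum L]
    refine Finset.sum_congr rfl fun b hb => ?_
    rw [hk_symm]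
    exact hk_top b L hb
  rw [Finset.sum_congr rfl inner, Finset.sum_add_distrib, row_sum, last]
  ring

/-- `Soff L = 2 ∑_{M<L} F M` (Abel summation). [folklore] -/
private lemma Soff_eq (L : ℕ) : Soff L = 2 * ∑ M ∈ range L, F M := by
  induction L with
  | zero => simp [Soff]
  | succ L ih => rw [Soff_succ, ih, Finset.sum_range_succ]; ring

/-- `F M ≤ R₀ M` — the tree's `sum_oddSingularFactor_two_pow_sub_one_le`. [cite: PintzRuzsa2003, (8.9)] -/
private lemma F_le (M : ℕ) : F M ≤ romanovConst * M := by
  unfold F g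
  exact sum_oddSingularFactor_two_pow_sub_one_le M

/-- `2 ∑_{M<L} M ≤ L²`. [folklore] -/
private lemma two_mul_sum_range_le_sq (L : ℕ) : 2 * ∑ M ∈ range L, (M : ℝ) ≤ (L : ℝ) ^ 2 := by
  have hnat : (∑ i ∈ range L, i) * 2 = L * (L - 1) := Finset.sum_range_id_mul_two L
  have hle : (∑ i ∈ range L, i) * 2 ≤ L * L :=
    hnat ▸ Nat.mul_le_mul_left L (Nat.sub_le L 1)
  have hcast : (((∑ i ∈ range L, i) * 2 : ℕ) : ℝ) ≤ ((L * L : ℕ) : ℝ) := by exact_mod_cast hle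
  push_cast at hcast
  calc 2 * ∑ M ∈ range L, (M : ℝ) = (∑ M ∈ range L, (M : ℝ)) * 2 := by ring
    _ ≤ (L : ℝ) * L := hcast
    _ = (L : ℝ) ^ 2 := by ring

/-- `Soff L ≤ R₀ L²`. [cite: PintzRuzsa2003, (8.9)–(8.14)] -/
private theorem Soff_le (L : ℕ) : Soff L ≤ romanovConst * (L : ℝ) ^ 2 := by
  rw [Soff_eq]
  have h1 : ∑ M ∈ range L, F M ≤ ∑ M ∈ range L, romanovConst * (M : ℝ) :=
    Finset.sum_le_sum fun M _ => F_le M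
  have hR : 0 ≤ romanovConst := romanovConst_nonneg
  calc 2 * ∑ M ∈ range L, F M ≤ 2 * ∑ M ∈ range L, romanovConst * (M : ℝ) := by linarith
    _ = romanovConst * (2 * ∑ M ∈ range L, (M : ℝ)) := by rw [← Finset.mul_sum]; ring
    _ ≤ romanovConst * (L : ℝ) ^ 2 := mul_le_mul_of_nonneg_left (two_mul_sum_range_le_sq L) hR

/-- `PowTwoShiftMeanLe 1.93841`: the diagonal-free power-of-two-shift mean is `≤ R₀ L² ≤ 1.93841 L²` for EVERY `L ≥ 1`
(Abel summation of the tree's row bound `sum_oddSingularFactor_two_pow_sub_one_le` + the kernel certificate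
`GoldbachLinnik.romanovConst_le_193841`). [cite: PintzRuzsa2003, §8 (8.8)–(8.14) (R₀; uniform mean form proved here)] -/
theorem powTwoShiftMeanLe_193841 : PowTwoShiftMeanLe 1.93841 := by
  intro L _
  have h2 : romanovConst * (L : ℝ) ^ 2 ≤ 1.93841 * (L : ℝ) ^ 2 :=
    mul_le_mul_of_nonneg_right romanovConst_le_193841 (sq_nonneg _)
  have := (Soff_le L).trans h2
  unfold Soff hk at this
  exact this

/-! ## §2 The two moments as pair counts (exact combinatorics) -/

/-- The representation pairs `(p, k)`, `p` prime, `k ≥ 1`, `p + 2^k ≤ N`. [folklore] -/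
def repPairs (N : ℕ) : Finset (ℕ × ℕ) :=
  ((range (N + 1)) ×ˢ (range (N + 1))).filter (fun x => x.1.Prime ∧ 1 ≤ x.2 ∧ x.1 + 2 ^ x.2 ≤ N)

/-- Membership in `repPairs`. [folklore] -/
private lemma mem_repPairs {N : ℕ} {x : ℕ × ℕ} : x ∈ repPairs N ↔ x.1.Prime ∧ 1 ≤ x.2 ∧ x.1 + 2 ^ x.2 ≤ N := by
  unfold repPairs
  rw [mem_filter, mem_product, mem_range, mem_range]
  constructor
  · exact fun h => h.2
  · intro h
    have hk : x.2 < 2 ^ x.2 := Nat.lt_two_pow_self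
    exact ⟨⟨by omega, by omega⟩, h⟩

/-- Exponents of representation pairs lie in `[1, log₂ N]`. [folklore] -/
private lemma snd_mem_Icc_of_mem_repPairs {N : ℕ} {x : ℕ × ℕ} (hx : x ∈ repPairs N) : x.2 ∈ Icc 1 (Nat.log 2 N) := by
  rw [mem_repPairs] at hx
  rw [mem_Icc]
  exact ⟨hx.2.1, Nat.le_log_of_pow_le (by norm_num) (by omega)⟩

/-- `r(n)` is the fibre of `(p, k) ↦ p + 2^k` over `n ≤ N`. [folklore] -/
private lemma romanovRep_eq_card_filter {N n : ℕ} (hn : n ≤ N) :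
    romanovRep n = ((repPairs N).filter (fun x => x.1 + 2 ^ x.2 = n)).card := by
  unfold romanovRep
  congr 1
  ext x
  rw [mem_filter, mem_filter, mem_product, mem_range, mem_range, mem_repPairs]
  constructor
  · rintro ⟨_, hp, hk, hx⟩
    exact ⟨⟨hp, hk, by omega⟩, hx⟩
  · rintro ⟨⟨hp, hk, _⟩, hx⟩
    have hk2 : x.2 < 2 ^ x.2 := Nat.lt_two_pow_self
    exact ⟨⟨by omega, by omega⟩, hp, hk, hx⟩

/-- The first moment `S₁(N) = ∑_{n ≤ N} r(n)`. [folklore] -/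
noncomputable def M1 (N : ℕ) : ℝ := ∑ n ∈ range (N + 1), (romanovRep n : ℝ)

/-- The second moment `S₂(N) = ∑_{n ≤ N} r(n)²`. [folklore] -/
noncomputable def M2 (N : ℕ) : ℝ := ∑ n ∈ range (N + 1), (romanovRep n : ℝ) ^ 2

/-- `S₁(N) = #repPairs N`. [folklore] -/
private lemma M1_eq (N : ℕ) : M1 N = ((repPairs N).card : ℝ) := by
  have hmap : ∀ x ∈ repPairs N, x.1 + 2 ^ x.2 ∈ range (N + 1) := by
    intro x hx
    rw [mem_repPairs] at hx
    rw [mem_range]; omega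
  unfold M1
  rw [card_eq_sum_card_fiberwise hmap]
  push_cast
  refine sum_congr rfl fun n hn => ?_
  rw [mem_range] at hn
  rw [romanovRep_eq_card_filter (Nat.lt_succ_iff.mp hn)]

/-- The collision set `{(x, y) ∈ repPairs² : p + 2^k = p' + 2^{k'}}`. [folklore] -/
def coll (N : ℕ) : Finset ((ℕ × ℕ) × (ℕ × ℕ)) :=
  (repPairs N ×ˢ repPairs N).filter (fun z => z.1.1 + 2 ^ z.1.2 = z.2.1 + 2 ^ z.2.2)

/-- Its off-diagonal part `k ≠ k'`. [folklore] -/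
def offColl (N : ℕ) : Finset ((ℕ × ℕ) × (ℕ × ℕ)) :=
  (repPairs N ×ˢ repPairs N).filter (fun z => z.1.1 + 2 ^ z.1.2 = z.2.1 + 2 ^ z.2.2 ∧ z.1.2 ≠ z.2.2)

/-- `S₂(N) = #coll N`. [folklore] -/
private lemma M2_eq (N : ℕ) : M2 N = ((coll N).card : ℝ) := by
  have h1 : M2 N = ∑ n ∈ range (N + 1), ((((repPairs N).filter (fun x => x.1 + 2 ^ x.2 = n)).card : ℝ)) ^ 2 := by
    unfold M2
    refine sum_congr rfl fun n hn => ?_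
    rw [mem_range] at hn
    rw [romanovRep_eq_card_filter (Nat.lt_succ_iff.mp hn)]
  have h2 := card_filter_prod_eq_sum_sq (repPairs N) (fun x : ℕ × ℕ => x.1 + 2 ^ x.2)
  unfold coll
  rw [h1, h2]
  symm
  refine sum_subset ?_ ?_
  · intro n hn
    rw [mem_image] at hn
    obtain ⟨x, hx, rfl⟩ := hn
    rw [mem_repPairs] at hx
    rw [mem_range]; omega
  · intro n _ hnot
    have : (repPairs N).filter (fun x => x.1 + 2 ^ x.2 = n) = ∅ := by
      rw [filter_eq_empty_iff]
      intro x hx hxn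
      exact hnot (mem_image.mpr ⟨x, hx, hxn⟩)
    rw [this]; simp

/-- Diagonal + off-diagonal: `#coll N = #repPairs N + #offColl N`. [folklore] -/
private lemma card_coll_eq (N : ℕ) : (coll N).card = (repPairs N).card + (offColl N).card := by
  have hsplit := card_filter_add_card_filter_not (s := coll N) (fun z => z.1.2 = z.2.2)
  have hdiag : (coll N).filter (fun z => z.1.2 = z.2.2) = (repPairs N).diag := by
    ext z
    rw [mem_filter, coll, mem_filter, mem_product, mem_diag]
    constructor
    · rintro ⟨⟨⟨h1, _⟩, hv⟩, hk⟩
      refine ⟨h1, Prod.ext ?_ hk⟩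
      rw [hk] at hv; omega
    · rintro ⟨h1, h12⟩
      rw [← h12]
      exact ⟨⟨⟨h1, h1⟩, rfl⟩, rfl⟩
  have hoff : (coll N).filter (fun z => ¬ z.1.2 = z.2.2) = offColl N := by
    unfold coll offColl
    rw [filter_filter]
  rw [hdiag, hoff, diag_card] at hsplit
  omega

/-- The index set of off-diagonal exponent pairs. [folklore] -/
def offIdx (K : ℕ) : Finset (ℕ × ℕ) := ((Icc 1 K) ×ˢ (Icc 1 K)).filter (fun ab => ab.1 ≠ ab.2)

/-- The shift attached to an exponent pair: `2^{max} − 2^{min}`. [folklore] -/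
def shift (ab : ℕ × ℕ) : ℕ := 2 ^ max ab.1 ab.2 - 2 ^ min ab.1 ab.2

/-- Each off-diagonal fibre injects into the prime pairs `(q, q + h)`, `q ≤ N`, `h = 2^{max} − 2^{min}`
(project to the smaller prime). [folklore] -/
private lemma card_fibre_le_pairCount (N : ℕ) (ab : ℕ × ℕ) (hab : ab.1 ≠ ab.2) :
    ((offColl N).filter (fun z => (z.1.2, z.2.2) = ab)).card ≤ pairCount N (shift ab) := by
  obtain ⟨a, b⟩ := ab
  simp only at hab
  unfold pairCount shift
  rcases Nat.lt_or_gt_of_ne hab with hlt | hgt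
  · -- `a < b`: the second prime is the smaller one
    rw [max_eq_right hlt.le, min_eq_left hlt.le]
    refine card_le_card_of_injOn (fun z => z.2.1) ?_ ?_
    · intro z hz
      rw [mem_coe, mem_filter, offColl, mem_filter, mem_product, mem_repPairs, mem_repPairs,
        Prod.mk.injEq] at hz
      obtain ⟨⟨⟨⟨hp, hk, hpk⟩, ⟨hp', hk', hpk'⟩⟩, hv, _⟩, h1, h2⟩ := hz
      rw [mem_coe, mem_filter, Nat.mem_primesLE]
      dsimp only
      rw [h1, h2] at hv
      have hle : 2 ^ a ≤ 2 ^ b := Nat.pow_le_pow_right (by norm_num) hlt.le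
      refine ⟨⟨(Nat.le_add_right _ _).trans hpk', hp'⟩, ?_⟩
      have : z.2.1 + (2 ^ b - 2 ^ a) = z.1.1 := by omega
      rw [this]; exact hp
    · intro z hz z' hz' heq
      rw [mem_coe, mem_filter, offColl, mem_filter, Prod.mk.injEq] at hz hz'
      obtain ⟨⟨_, hv, _⟩, h1, h2⟩ := hz
      obtain ⟨⟨_, hv', _⟩, h1', h2'⟩ := hz'
      simp only at heq
      rw [h1, h2] at hv
      rw [h1', h2'] at hv'
      refine Prod.ext (Prod.ext ?_ (by rw [h1, h1'])) (Prod.ext heq (by rw [h2, h2']))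
      omega
  · -- `b < a`: the first prime is the smaller one
    rw [max_eq_left hgt.le, min_eq_right hgt.le]
    refine card_le_card_of_injOn (fun z => z.1.1) ?_ ?_
    · intro z hz
      rw [mem_coe, mem_filter, offColl, mem_filter, mem_product, mem_repPairs, mem_repPairs,
        Prod.mk.injEq] at hz
      obtain ⟨⟨⟨⟨hp, hk, hpk⟩, ⟨hp', hk', hpk'⟩⟩, hv, _⟩, h1, h2⟩ := hz
      rw [mem_coe, mem_filter, Nat.mem_primesLE]
      dsimp only
      rw [h1, h2] at hv
      have hle : 2 ^ b ≤ 2 ^ a := Nat.pow_le_pow_right (by norm_num) hgt.le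
      refine ⟨⟨(Nat.le_add_right _ _).trans hpk, hp⟩, ?_⟩
      have : z.1.1 + (2 ^ a - 2 ^ b) = z.2.1 := by omega
      rw [this]; exact hp'
    · intro z hz z' hz' heq
      rw [mem_coe, mem_filter, offColl, mem_filter, Prod.mk.injEq] at hz hz'
      obtain ⟨⟨_, hv, _⟩, h1, h2⟩ := hz
      obtain ⟨⟨_, hv', _⟩, h1', h2'⟩ := hz'
      simp only at heq
      rw [h1, h2] at hv
      rw [h1', h2'] at hv'
      refine Prod.ext (Prod.ext heq (by rw [h1, h1'])) (Prod.ext ?_ (by rw [h2, h2']))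
      omega

/-- **Second moment ≤ first moment + pair counts over the shifts** (Romanov's reduction of `∑ r(n)²` to prime pairs
`p′ − p = 2^{k} − 2^{k′}`, exact form): `S₂(N) ≤ S₁(N) + ∑_{a ≠ b ≤ log₂ N} π_{2^{max}−2^{min}}(N)`.
[cite: Nathanson1996, §7.6 Theorem 7.11 (Romanov's theorem) — proof, second-moment step; exact combinatorial form proved here] [cite: ChenSun2004, proof of Thm 1] -/
theorem M2_le (N : ℕ) :
    M2 N ≤ M1 N + ∑ ab ∈ offIdx (Nat.log 2 N), (pairCount N (shift ab) : ℝ) := by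
  rw [M2_eq, M1_eq, card_coll_eq]
  push_cast
  have hmap : ∀ z ∈ offColl N, (z.1.2, z.2.2) ∈ offIdx (Nat.log 2 N) := by
    intro z hz
    unfold offColl at hz
    rw [mem_filter, mem_product] at hz
    unfold offIdx
    rw [mem_filter, mem_product]
    dsimp only
    exact ⟨⟨snd_mem_Icc_of_mem_repPairs hz.1.1, snd_mem_Icc_of_mem_repPairs hz.1.2⟩, hz.2.2⟩
  have h := card_eq_sum_card_fiberwise hmap
  have hle : ((offColl N).card : ℝ) ≤ ∑ ab ∈ offIdx (Nat.log 2 N), (pairCount N (shift ab) : ℝ) := by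
    rw [h]
    push_cast
    refine sum_le_sum fun ab hab => ?_
    have hab' : ab.1 ≠ ab.2 := by
      unfold offIdx at hab
      exact (mem_filter.mp hab).2
    exact_mod_cast card_fibre_le_pairCount N ab hab'
  linarith

/-- **First moment ≥ prime counts over the shifts**: `S₁(N) ≥ ∑_{k=1}^{log₂ N} π(N − 2^k)`.
[cite: Nathanson1996, §7.6 Lemma 7.10 (first moment; exact form proved here)] [cite: Pintz2006, Prop. 2] -/
theorem M1_ge (N : ℕ) :
    ∑ k ∈ Icc 1 (Nat.log 2 N), (Nat.primeCounting (N - 2 ^ k) : ℝ) ≤ M1 N := by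
  rw [M1_eq]
  have hmap : ∀ x ∈ repPairs N, x.2 ∈ Icc 1 (Nat.log 2 N) := fun x hx => snd_mem_Icc_of_mem_repPairs hx
  rw [card_eq_sum_card_fiberwise hmap]
  push_cast
  refine sum_le_sum fun k hk => ?_
  rw [← Nat.primesLE_card_eq_primeCounting]
  rw [mem_Icc] at hk
  have hN0 : N ≠ 0 := by
    rintro rfl
    rw [Nat.log_zero_right] at hk
    omega
  have h2k : 2 ^ k ≤ N := (Nat.pow_le_pow_right (by norm_num) hk.2).trans (Nat.pow_log_le_self 2 hN0)
  exact_mod_cast card_le_card_of_injOn (fun p => (p, k)) (fun p hp => by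
      rw [mem_coe, Nat.mem_primesLE] at hp
      rw [mem_coe, mem_filter, mem_repPairs]
      dsimp only
      exact ⟨⟨hp.2, hk.1, by omega⟩, rfl⟩)
    (fun p _ p' _ h => by simpa using h)

/-! ## §3 The analytic inputs applied -/

/-- `∑_{a ≠ b ∈ [1,K]} π_{shift}(N) ≤ A·R·K²·N/log²N` under a uniform pair sieve and `PowTwoShiftMeanLe R`. [folklore] -/
private theorem offdiag_le {A R x₀ : ℝ} (hA : 0 ≤ A) (hPS : UniformPairSieve A x₀) (hR : PowTwoShiftMeanLe R)
    {N : ℕ} (hx : x₀ ≤ (N : ℝ)) {K : ℕ} (hK : 1 ≤ K) :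
    ∑ ab ∈ offIdx K, (pairCount N (shift ab) : ℝ) ≤ A * R * (K : ℝ) ^ 2 * (N : ℝ) / Real.log (N : ℝ) ^ 2 := by
  have hterm : ∀ ab ∈ offIdx K, (pairCount N (shift ab) : ℝ) ≤
      A * (N : ℝ) / Real.log (N : ℝ) ^ 2 * oddSingularFactor (2 ^ (max ab.1 ab.2 - min ab.1 ab.2) - 1) := by
    intro ab hab
    unfold offIdx at hab
    rw [mem_filter, mem_product, mem_Icc, mem_Icc] at hab
    obtain ⟨⟨⟨ha1, _⟩, ⟨hb1, _⟩⟩, hne⟩ := hab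
    have hd : 1 ≤ max ab.1 ab.2 - min ab.1 ab.2 := by
      rcases Nat.lt_or_gt_of_ne hne with h | h
      · rw [max_eq_right h.le, min_eq_left h.le]; omega
      · rw [max_eq_left h.le, min_eq_right h.le]; omega
    have hm : 1 ≤ min ab.1 ab.2 := le_min ha1 hb1
    set d := max ab.1 ab.2 - min ab.1 ab.2 with hd_def
    set m := min ab.1 ab.2 with hm_def
    have hshift : shift ab = 2 ^ m * (2 ^ d - 1) := by
      unfold shift
      have : max ab.1 ab.2 = m + d := by omega
      rw [this, pow_add, Nat.mul_sub_one]
    have h2d : 2 ≤ 2 ^ d := by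
      calc 2 = 2 ^ 1 := by norm_num
        _ ≤ 2 ^ d := Nat.pow_le_pow_right (by norm_num) hd
    have hne0 : 2 ^ d - 1 ≠ 0 := by omega
    have hshift_ne : shift ab ≠ 0 := by
      rw [hshift]; exact Nat.mul_ne_zero (by positivity) hne0
    have hshift_even : Even (shift ab) := by
      rw [hshift]
      have : Even (2 ^ m) := (Nat.even_pow' (by omega)).mpr (by norm_num)
      exact this.mul_right _
    have h1 := hPS N (shift ab) hx hshift_ne hshift_even
    rw [hshift, oddSingularFactor_two_pow_mul m hne0] at h1
    rw [hshift]
    calc (pairCount N (2 ^ m * (2 ^ d - 1)) : ℝ)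
        ≤ A * oddSingularFactor (2 ^ d - 1) * (N : ℝ) / Real.log (N : ℝ) ^ 2 := h1
      _ = A * (N : ℝ) / Real.log (N : ℝ) ^ 2 * oddSingularFactor (2 ^ d - 1) := by ring
  have hsum := sum_le_sum hterm
  rw [← mul_sum] at hsum
  have hoff : ∑ ab ∈ offIdx K, oddSingularFactor (2 ^ (max ab.1 ab.2 - min ab.1 ab.2) - 1) =
      ∑ a ∈ Icc 1 K, ∑ b ∈ Icc 1 K,
        (if a = b then (0 : ℝ) else oddSingularFactor (2 ^ (max a b - min a b) - 1)) := by
    unfold offIdx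
    rw [sum_filter, sum_product]
    refine sum_congr rfl fun a _ => sum_congr rfl fun b _ => ?_
    by_cases hab : a = b
    · simp [hab]
    · simp [hab]
  have hRK := hR K hK
  rw [← hoff] at hRK
  have hcoef : 0 ≤ A * (N : ℝ) / Real.log (N : ℝ) ^ 2 := by positivity
  calc ∑ ab ∈ offIdx K, (pairCount N (shift ab) : ℝ)
      ≤ A * (N : ℝ) / Real.log (N : ℝ) ^ 2 *
          ∑ ab ∈ offIdx K, oddSingularFactor (2 ^ (max ab.1 ab.2 - min ab.1 ab.2) - 1) := hsum
    _ ≤ A * (N : ℝ) / Real.log (N : ℝ) ^ 2 * (R * (K : ℝ) ^ 2) :=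
          mul_le_mul_of_nonneg_left hRK hcoef
    _ = A * R * (K : ℝ) ^ 2 * (N : ℝ) / Real.log (N : ℝ) ^ 2 := by ring

/-- `log₂ N ≤ log N / log 2` for the integer logarithm. [folklore] -/
private lemma natlog_le (N : ℕ) (hN : N ≠ 0) : (Nat.log 2 N : ℝ) ≤ Real.log (N : ℝ) / Real.log 2 := by
  have hlog2 : 0 < Real.log 2 := Real.log_pos one_lt_two
  rw [le_div_iff₀ hlog2, ← Real.log_pow]
  apply Real.log_le_log (by positivity)
  exact_mod_cast Nat.pow_log_le_self 2 hN

/-- **Second moment, final form**: `S₂(N) ≤ S₁(N) + (A·R/log²2)·N` for `N ≥ max(x₀, 2)`, from a uniform pair sieve with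
constant `A` and `PowTwoShiftMeanLe R`. [cite: Nathanson1996, §7.6 Theorem 7.11 (Romanov's theorem) — proof, second-moment step; explicit form proved here] -/
theorem M2_le_final {A R x₀ : ℝ} (hA : 0 ≤ A) (hPS : UniformPairSieve A x₀) (hR : PowTwoShiftMeanLe R)
    {N : ℕ} (hx : x₀ ≤ (N : ℝ)) (hN : 2 ≤ N) :
    M2 N ≤ M1 N + A * R / Real.log 2 ^ 2 * (N : ℝ) := by
  have hK : 1 ≤ Nat.log 2 N := Nat.le_log_of_pow_le (by norm_num) (by simpa using hN)
  have h1 := M2_le N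
  have h2 := offdiag_le hA hPS hR hx hK
  have hR0 : 0 ≤ R := by
    have := hR 1 le_rfl
    simp at this
    linarith
  have hlog2 : 0 < Real.log 2 := Real.log_pos one_lt_two
  have hlogN : 0 < Real.log (N : ℝ) := Real.log_pos (by exact_mod_cast hN)
  have hKle := natlog_le N (by omega)
  have hK0 : (0 : ℝ) ≤ Nat.log 2 N := Nat.cast_nonneg _
  have hK2 : (Nat.log 2 N : ℝ) ^ 2 ≤ (Real.log (N : ℝ) / Real.log 2) ^ 2 := pow_le_pow_left₀ hK0 hKle 2
  have h3 : A * R * (Nat.log 2 N : ℝ) ^ 2 * (N : ℝ) / Real.log (N : ℝ) ^ 2 ≤ A * R / Real.log 2 ^ 2 * (N : ℝ) := by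
    have hARN : 0 ≤ A * R * (N : ℝ) / Real.log (N : ℝ) ^ 2 := by positivity
    calc A * R * (Nat.log 2 N : ℝ) ^ 2 * (N : ℝ) / Real.log (N : ℝ) ^ 2
        = A * R * (N : ℝ) / Real.log (N : ℝ) ^ 2 * (Nat.log 2 N : ℝ) ^ 2 := by ring
      _ ≤ A * R * (N : ℝ) / Real.log (N : ℝ) ^ 2 * (Real.log (N : ℝ) / Real.log 2) ^ 2 :=
          mul_le_mul_of_nonneg_left hK2 hARN
      _ = A * R / Real.log 2 ^ 2 * (N : ℝ) := by
          field_simp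
  linarith

/-- Concavity of `log`: `log₂ u ≤ 2 − 2/u` on `[1, 2]` (the chord of `log` over `[1/2, 1]`, at `1/u`). [folklore] -/
private lemma log_le_chord {u : ℝ} (h1 : 1 ≤ u) (h2 : u ≤ 2) : Real.log u ≤ (2 - 2 / u) * Real.log 2 := by
  have hu : 0 < u := by linarith
  have hconc := (strictConcaveOn_log_Ioi).concaveOn
  have hw1 : 1 / 2 ≤ 1 / u := by
    rw [div_le_div_iff₀ (by norm_num) hu]; linarith
  have hw2 : 1 / u ≤ 1 := by
    rw [div_le_one hu]; exact h1
  have key := hconc.2 (show (1 / 2 : ℝ) ∈ Set.Ioi (0 : ℝ) by norm_num) (show (1 : ℝ) ∈ Set.Ioi (0 : ℝ) by norm_num)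
    (show (0 : ℝ) ≤ 2 - 2 * (1 / u) by linarith) (show (0 : ℝ) ≤ 2 * (1 / u) - 1 by linarith)
    (show (2 - 2 * (1 / u)) + (2 * (1 / u) - 1) = (1 : ℝ) by ring)
  simp only [smul_eq_mul, Real.log_one, mul_zero, add_zero, mul_one] at key
  have e0 : (2 - 2 * (1 / u)) * (1 / 2) + (2 * (1 / u) - 1) = 1 / u := by ring
  rw [e0] at key
  have e1 : Real.log (1 / 2) = -Real.log 2 := by rw [one_div, Real.log_inv]
  have e2 : Real.log (1 / u) = -Real.log u := by rw [one_div, Real.log_inv]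
  rw [e1, e2] at key
  have e3 : (2 - 2 / u) = 2 - 2 * (1 / u) := by ring
  rw [e3]
  linarith

/-- The floor-log correction: `K·N − 2·2^K ≥ N (log N/log 2 − 2)` for `K = log₂ N`, `N ≥ 1`. [folklore] -/
private lemma natlog_main (N : ℕ) (hN : 1 ≤ N) :
    (N : ℝ) * (Real.log (N : ℝ) / Real.log 2 - 2) ≤ (Nat.log 2 N : ℝ) * N - 2 * (2 : ℝ) ^ (Nat.log 2 N) := by
  set K := Nat.log 2 N with hK
  have hlog2 : 0 < Real.log 2 := Real.log_pos one_lt_two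
  have hpow : (0 : ℝ) < (2 : ℝ) ^ K := by positivity
  have hlo : (2 : ℝ) ^ K ≤ (N : ℝ) := by exact_mod_cast Nat.pow_log_le_self 2 (by omega)
  have hhi : (N : ℝ) ≤ 2 * (2 : ℝ) ^ K := by
    have := Nat.lt_pow_succ_log_self (b := 2) (by norm_num) N
    rw [pow_succ] at this
    have : (N : ℝ) < (2 : ℝ) ^ K * 2 := by exact_mod_cast this
    linarith
  -- `u = N / 2^K ∈ [1, 2]`
  set u := (N : ℝ) / (2 : ℝ) ^ K with hu
  have hu1 : 1 ≤ u := by rw [hu, le_div_iff₀ hpow]; linarith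
  have hu2 : u ≤ 2 := by rw [hu, div_le_iff₀ hpow]; linarith
  have hupos : 0 < u := by linarith
  have hchord := log_le_chord hu1 hu2
  -- `log N = K log 2 + log u`
  have hlogN : Real.log (N : ℝ) = (K : ℝ) * Real.log 2 + Real.log u := by
    have hNpos : (0 : ℝ) < N := by exact_mod_cast (show 0 < N by omega)
    rw [hu, Real.log_div hNpos.ne' hpow.ne', Real.log_pow]; ring
  -- `2/u = 2·2^K/N`
  have hNpos : (0 : ℝ) < N := by exact_mod_cast (show 0 < N by omega)
  have h2u : 2 / u * (N : ℝ) = 2 * (2 : ℝ) ^ K := by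
    rw [hu]; field_simp
  -- divide the chord inequality by `log 2` and multiply by `N`
  have h3 : Real.log (N : ℝ) / Real.log 2 - 2 ≤ (K : ℝ) - 2 / u := by
    rw [hlogN, add_div, mul_div_assoc, div_self hlog2.ne', mul_one]
    have : Real.log u / Real.log 2 ≤ 2 - 2 / u := by rw [div_le_iff₀ hlog2]; exact hchord
    linarith
  calc (N : ℝ) * (Real.log (N : ℝ) / Real.log 2 - 2) ≤ (N : ℝ) * ((K : ℝ) - 2 / u) :=
        mul_le_mul_of_nonneg_left h3 hNpos.le
    _ = (K : ℝ) * N - 2 / u * (N : ℝ) := by ring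
    _ = (K : ℝ) * N - 2 * (2 : ℝ) ^ K := by rw [h2u]

/-- `∑_{k=1}^{K} 2^k = 2^{K+1} − 2`. [folklore] -/
private lemma sum_two_pow_Icc (K : ℕ) : ∑ k ∈ Icc 1 K, (2 : ℝ) ^ k = 2 * (2 : ℝ) ^ K - 2 := by
  induction K with
  | zero => simp
  | succ K ih => rw [Finset.sum_Icc_succ_top (by omega), ih, pow_succ]; ring

/-- `log 5393 > 2`. [folklore] -/
private lemma two_lt_log_5393 : (2 : ℝ) < Real.log 5393 := by
  have h1 : Real.exp 2 < 5393 := by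
    have he := Real.exp_one_lt_d9
    have h : Real.exp 2 = Real.exp 1 * Real.exp 1 := by rw [← Real.exp_add]; norm_num
    rw [h]; nlinarith [Real.exp_pos 1]
  have h2 := Real.log_lt_log (Real.exp_pos 2) h1
  rwa [Real.log_exp] at h2

/-- **First moment, final form** from `PrimeCountingLower 5393`: for `N ≥ 10786`,
`S₁(N)·(log N − 1) ≥ N (log N/log 2 − 2) − 5393`. [cite: Nathanson1996, §7.6 Lemma 7.10 (first moment; explicit form proved here)] -/
theorem M1_ge_final (hπ : PrimeCountingLower 5393) {N : ℕ} (hN : 10786 ≤ N) :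
    (N : ℝ) * (Real.log (N : ℝ) / Real.log 2 - 2) - 5393 ≤ M1 N * (Real.log (N : ℝ) - 1) := by
  set K := Nat.log 2 N with hK
  set L := Real.log (N : ℝ) with hL
  have hNpos : (0 : ℝ) < N := by exact_mod_cast (show 0 < N by omega)
  have hK1 : 1 ≤ K := Nat.le_log_of_pow_le (by norm_num) (by omega)
  have hpowK : 2 ^ K ≤ N := Nat.pow_log_le_self 2 (by omega)
  -- `log 5393 > 1`, so `log x − 1 > 0` for `x ≥ 5393`
  have hlog5393 := two_lt_log_5393
  have hL1 : 1 < L - 1 := by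
    have : Real.log 5393 ≤ L := Real.log_le_log (by norm_num) (by exact_mod_cast (show 5393 ≤ N by omega))
    linarith
  -- per-shift bound: `π(N − 2^k)(L − 1) ≥ N − 2^k − [k = K]·5393`, uniformly `≥ N − 2^k − c_k`
  have hshift : ∀ k ∈ Icc 1 K, ((N : ℝ) - (2 : ℝ) ^ k) - (if k = K then (5393 : ℝ) else 0)
      ≤ (Nat.primeCounting (N - 2 ^ k) : ℝ) * (L - 1) := by
    intro k hk
    rw [mem_Icc] at hk
    have hpowk : 2 ^ k ≤ N := (Nat.pow_le_pow_right (by norm_num) hk.2).trans hpowK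
    have hcast : ((N - 2 ^ k : ℕ) : ℝ) = (N : ℝ) - (2 : ℝ) ^ k := by
      rw [Nat.cast_sub hpowk]; push_cast; ring
    by_cases hbig : 5393 ≤ N - 2 ^ k
    · -- Dusart applies at `x = N − 2^k`
      have hx := hπ (N - 2 ^ k) hbig
      have hxpos : (0 : ℝ) < ((N - 2 ^ k : ℕ) : ℝ) := by exact_mod_cast (show 0 < N - 2 ^ k by omega)
      have hlogx1 : 1 < Real.log ((N - 2 ^ k : ℕ) : ℝ) - 1 := by
        have : Real.log 5393 ≤ Real.log ((N - 2 ^ k : ℕ) : ℝ) :=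
          Real.log_le_log (by norm_num) (by exact_mod_cast hbig)
        linarith
      have hlogxL : Real.log ((N - 2 ^ k : ℕ) : ℝ) - 1 ≤ L - 1 := by
        have : Real.log ((N - 2 ^ k : ℕ) : ℝ) ≤ L := Real.log_le_log hxpos (by rw [hcast]; linarith [pow_pos (show (0:ℝ) < 2 by norm_num) k])
        linarith
      rw [div_le_iff₀ (by linarith)] at hx
      -- `x ≤ π(x)(log x − 1) ≤ π(x)(L − 1)`
      have hπ0 : (0 : ℝ) ≤ Nat.primeCounting (N - 2 ^ k) := Nat.cast_nonneg _
      have : ((N - 2 ^ k : ℕ) : ℝ) ≤ (Nat.primeCounting (N - 2 ^ k) : ℝ) * (L - 1) :=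
        hx.trans (mul_le_mul_of_nonneg_left hlogxL hπ0)
      rw [hcast] at this
      have hc : (0 : ℝ) ≤ (if k = K then (5393 : ℝ) else 0) := by split_ifs <;> norm_num
      linarith
    · -- only the top shift can be short, and then the claim is `≤ 0 ≤ π·(L−1)`
      have hkK : k = K := by
        by_contra hne
        have hlt : k < K := lt_of_le_of_ne hk.2 hne
        have : 2 ^ (k + 1) ≤ 2 ^ K := Nat.pow_le_pow_right (by norm_num) hlt
        rw [pow_succ] at this
        omega
      rw [if_pos hkK]
      have hπ0 : (0 : ℝ) ≤ (Nat.primeCounting (N - 2 ^ k) : ℝ) * (L - 1) :=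
        mul_nonneg (Nat.cast_nonneg _) (by linarith)
      have : (N : ℝ) - (2 : ℝ) ^ k < 5393 := by
        have h' : ((N - 2 ^ k : ℕ) : ℝ) < 5393 := by exact_mod_cast (show N - 2 ^ k < 5393 by omega)
        rw [hcast] at h'; exact h'
      linarith
  have hsum := sum_le_sum hshift
  rw [sum_sub_distrib, sum_sub_distrib, sum_const, Nat.card_Icc, sum_two_pow_Icc, sum_ite_eq',
    if_pos (mem_Icc.mpr ⟨hK1, le_rfl⟩), ← sum_mul] at hsum
  simp only [add_tsub_cancel_right, nsmul_eq_mul] at hsum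
  have hmain := natlog_main N (by omega)
  have hM1 := M1_ge N
  have hM1' : (∑ k ∈ Icc 1 K, (Nat.primeCounting (N - 2 ^ k) : ℝ)) * (L - 1) ≤ M1 N * (L - 1) :=
    mul_le_mul_of_nonneg_right hM1 (by linarith)
  linarith

/-! ## §4 Cauchy–Schwarz and the numbers -/

/-- **Density from the two moments** (Romanov's Cauchy–Schwarz step, explicit): if `s·N ≤ S₁` (`s > 0`) and
`S₂ ≤ S₁ + B·N` (`B ≥ 0`) then `#romanovSet N ≥ s²/(s + B) · N`. [cite: Nathanson1996, §7.6 Theorem 7.11 (Romanov's theorem) — proof, Cauchy–Schwarz step] -/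
theorem density_of_moments {N : ℕ} {s B : ℝ} (hs : 0 < s) (hB : 0 ≤ B)
    (h1 : s * (N : ℝ) ≤ M1 N) (h2 : M2 N ≤ M1 N + B * (N : ℝ)) :
    s ^ 2 / (s + B) * (N : ℝ) ≤ ((romanovSet N).card : ℝ) := by
  have hCS := sq_sum_le_card_support_mul (range (N + 1)) romanovRep
  rw [filter_pos_eq_romanovSet romanovRep_pos_iff N] at hCS
  change M1 N ^ 2 ≤ ((romanovSet N).card : ℝ) * M2 N at hCS
  have hN0 : (0 : ℝ) ≤ N := Nat.cast_nonneg _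
  have hD0 : (0 : ℝ) ≤ (romanovSet N).card := Nat.cast_nonneg _
  have hM1pos : 0 ≤ M1 N := le_trans (by positivity) h1
  -- `M1² ≤ D (M1 + BN)` and `BN ≤ (B/s) M1`
  have h3 : M1 N ^ 2 ≤ ((romanovSet N).card : ℝ) * (M1 N + B * N) :=
    hCS.trans (mul_le_mul_of_nonneg_left h2 hD0)
  have h4 : B * (N : ℝ) ≤ B / s * M1 N := by
    rw [div_mul_eq_mul_div, le_div_iff₀ hs]
    calc B * (N : ℝ) * s = B * (s * N) := by ring
      _ ≤ B * M1 N := mul_le_mul_of_nonneg_left h1 hB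
  have h5 : M1 N ^ 2 ≤ ((romanovSet N).card : ℝ) * (1 + B / s) * M1 N := by
    calc M1 N ^ 2 ≤ ((romanovSet N).card : ℝ) * (M1 N + B / s * M1 N) :=
          h3.trans (mul_le_mul_of_nonneg_left (by linarith) hD0)
      _ = ((romanovSet N).card : ℝ) * (1 + B / s) * M1 N := by ring
  -- conclude: either `M1 = 0` (then `N = 0`) or divide by `M1`
  rcases eq_or_lt_of_le hM1pos with hz | hpos
  · have : s * (N : ℝ) ≤ 0 := by rw [hz]; exact h1
    have hN : (N : ℝ) = 0 := by nlinarith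
    rw [hN, mul_zero]; exact hD0
  · have h6 : M1 N ≤ ((romanovSet N).card : ℝ) * (1 + B / s) := by
      have := h5; rw [sq] at this
      exact le_of_mul_le_mul_right (by linarith) hpos
    have h7 : s * (N : ℝ) ≤ ((romanovSet N).card : ℝ) * (1 + B / s) := h1.trans h6
    have h8 : s ^ 2 / (s + B) = s / (1 + B / s) := by
      field_simp
    rw [h8, div_mul_eq_mul_div, div_le_iff₀ (by positivity)]
    linarith

/-- **The analytic branch, Dusart-shaped `π` input.** A uniform pair sieve with constant `A ≤ 10.5627` from `x₀` on,
`PrimeCountingLower 5393`, and `N ≥ max(x₀, 2^20)` give `#romanovSet N ≥ N/25`.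
[cite: Nathanson1996, §7.6 Theorem 7.11 (Romanov's theorem) — explicit form proved here] -/
theorem density_ge {A x₀ : ℝ} (hA : 0 ≤ A) (hA' : A ≤ 10.5627) (hPS : UniformPairSieve A x₀)
    (hπ : PrimeCountingLower 5393) {N : ℕ} (hx : x₀ ≤ (N : ℝ)) (hN : 2 ^ 20 ≤ N) :
    (1 / 25 : ℝ) * (N : ℝ) ≤ ((romanovSet N).card : ℝ) := by
  have hN' : (1048576 : ℝ) ≤ N := by exact_mod_cast (show 1048576 ≤ N by norm_num at hN; omega)
  have hlog2lo : (0.6931471803 : ℝ) < Real.log 2 := Real.log_two_gt_d9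
  have hlog2hi : Real.log 2 < 0.6931471808 := Real.log_two_lt_d9
  set L := Real.log (N : ℝ) with hL
  have hL : 20 * Real.log 2 ≤ L := by
    have h := Real.log_le_log (by positivity) (show ((2 : ℝ) ^ 20) ≤ (N : ℝ) by exact_mod_cast hN)
    rw [Real.log_pow] at h
    norm_num at h
    rw [hL]; exact h
  have hL' : (13.86294 : ℝ) ≤ L := by linarith
  -- first moment: `M1 ≥ 1.398 N`
  have h1 := M1_ge_final hπ (N := N) (by norm_num at hN; omega)
  have hinv : (1.4426 : ℝ) * L ≤ L / Real.log 2 := by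
    rw [le_div_iff₀ (by linarith)]; nlinarith
  have hM1 : (1.398 : ℝ) * N ≤ M1 N := by
    have hL1 : 0 < L - 1 := by linarith
    have hkey : (1.398 : ℝ) * N * (L - 1) ≤ (N : ℝ) * (L / Real.log 2 - 2) - 5393 := by
      have : (N : ℝ) * (1.4426 * L) ≤ (N : ℝ) * (L / Real.log 2) := mul_le_mul_of_nonneg_left hinv (by linarith)
      nlinarith [mul_le_mul_of_nonneg_left hL' (show (0:ℝ) ≤ N by linarith)]
    exact le_of_mul_le_mul_right (hkey.trans h1) hL1
  -- second moment: `M2 ≤ M1 + 42.62 N`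
  have h2 := M2_le_final hA hPS powTwoShiftMeanLe_193841 hx (by norm_num at hN; omega)
  have hB : A * 1.93841 / Real.log 2 ^ 2 ≤ 42.62 := by
    rw [div_le_iff₀ (by positivity)]
    nlinarith
  have hM2 : M2 N ≤ M1 N + 42.62 * (N : ℝ) := by
    have : A * 1.93841 / Real.log 2 ^ 2 * (N : ℝ) ≤ 42.62 * (N : ℝ) :=
      mul_le_mul_of_nonneg_right hB (by linarith)
    linarith
  have h3 := density_of_moments (by norm_num) (by norm_num) hM1 hM2
  have hc : (1 / 25 : ℝ) ≤ (1.398 : ℝ) ^ 2 / (1.398 + 42.62) := by norm_num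
  calc (1 / 25 : ℝ) * N ≤ (1.398 : ℝ) ^ 2 / (1.398 + 42.62) * N := mul_le_mul_of_nonneg_right hc (by linarith)
    _ ≤ _ := h3

/-! ## §5 The range `4 ≤ N < 2^20`: ONE shift suffices — `#romanovSet N ≥ π(N − 2) ≥ N/25` (up to `e^{25.9}`) -/

/-- `π(N − 2) ≤ #romanovSet N` (the representations `p + 2¹`). [folklore] -/
private theorem primeCounting_le_card_romanovSet (N : ℕ) :
    Nat.primeCounting (N - 2) ≤ (romanovSet N).card := by
  rw [← Nat.primesLE_card_eq_primeCounting]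
  refine card_le_card_of_injOn (fun p => p + 2) ?_ ?_
  · intro p hp
    rw [mem_coe, Nat.mem_primesLE] at hp
    have h2 := hp.2.two_le
    rw [mem_coe, mem_romanovSet]
    dsimp only
    exact ⟨by omega, p, 1, hp.2, le_rfl, by ring⟩
  · intro p _ q _ h
    simpa using h

/-- The first `216` primes (`p₂₁₆ = 1321`), certified in the kernel by trial division. [folklore] -/
def firstPrimes : List ℕ :=
  [2, 3, 5, 7, 11, 13, 17, 19, 23, 29, 31, 37, 41, 43, 47, 53, 59, 61, 67, 71, 73, 79, 83, 89, 97, 101, 103, 107,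
   109, 113, 127, 131, 137, 139, 149, 151, 157, 163, 167, 173, 179, 181, 191, 193, 197, 199, 211, 223, 227, 229, 233,
   239, 241, 251, 257, 263, 269, 271, 277, 281, 283, 293, 307, 311, 313, 317, 331, 337, 347, 349, 353, 359, 367, 373,
   379, 383, 389, 397, 401, 409, 419, 421, 431, 433, 439, 443, 449, 457, 461, 463, 467, 479, 487, 491, 499, 503, 509,
   521, 523, 541, 547, 557, 563, 569, 571, 577, 587, 593, 599, 601, 607, 613, 617, 619, 631, 641, 643, 647, 653, 659,
   661, 673, 677, 683, 691, 701, 709, 719, 727, 733, 739, 743, 751, 757, 761, 769, 773, 787, 797, 809, 811, 821, 823,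
   827, 829, 839, 853, 857, 859, 863, 877, 881, 883, 887, 907, 911, 919, 929, 937, 941, 947, 953, 967, 971, 977, 983,
   991, 997, 1009, 1013, 1019, 1021, 1031, 1033, 1039, 1049, 1051, 1061, 1063, 1069, 1087, 1091, 1093, 1097, 1103,
   1109, 1117, 1123, 1129, 1151, 1153, 1163, 1171, 1181, 1187, 1193, 1201, 1213, 1217, 1223, 1229, 1231, 1237, 1249,
   1259, 1277, 1279, 1283, 1289, 1291, 1297, 1301, 1303, 1307, 1319, 1321]

set_option maxRecDepth 100000 in
/-- Every entry of `firstPrimes` is prime (kernel trial division). [folklore] -/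
private theorem firstPrimes_prime : ∀ p ∈ firstPrimes, p.Prime := by
  decide +kernel

set_option maxRecDepth 100000 in
/-- `firstPrimes` has no duplicates. [folklore] -/
private theorem firstPrimes_nodup : firstPrimes.Nodup := by
  decide +kernel

/-- `π(x) ≥ #{p ∈ firstPrimes : p ≤ x}`. [folklore] -/
private theorem le_primeCounting_of (x n : ℕ) (h : n ≤ (firstPrimes.filter (· ≤ x)).length) :
    n ≤ Nat.primeCounting x := by
  rw [← Nat.primesLE_card_eq_primeCounting]
  have hnd : (firstPrimes.filter (· ≤ x)).Nodup := firstPrimes_nodup.filter _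
  rw [← List.toFinset_card_of_nodup hnd] at h
  refine h.trans (card_le_card ?_)
  intro p hp
  rw [List.mem_toFinset, List.mem_filter] at hp
  rw [Nat.mem_primesLE]
  exact ⟨by simpa using hp.2, firstPrimes_prime p hp.1⟩

set_option maxRecDepth 100000 in
/-- `4 ≤ N < 5395`: `N/25 ≤ π(N − 2)` by five checkpoints (`π(2), π(23), π(223), π(1198), π(4898) ≥ 1, 9, 48, 196, 216`). [folklore] -/
private theorem small_range {N : ℕ} (h4 : 4 ≤ N) (h : N < 5395) :
    (1 / 25 : ℝ) * (N : ℝ) ≤ (Nat.primeCounting (N - 2) : ℝ) := by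
  have mono : ∀ {a b : ℕ}, a ≤ b → Nat.primeCounting a ≤ Nat.primeCounting b :=
    fun hab => Nat.monotone_primeCounting hab
  have step : ∀ (x n M : ℕ), n ≤ Nat.primeCounting x → x ≤ N - 2 → N < M → (M : ℝ) ≤ 25 * n →
      (1 / 25 : ℝ) * (N : ℝ) ≤ (Nat.primeCounting (N - 2) : ℝ) := by
    intro x n M hn hx hM hMn
    have h1 : (n : ℝ) ≤ Nat.primeCounting (N - 2) := by exact_mod_cast hn.trans (mono hx)
    have h2 : (N : ℝ) < M := by exact_mod_cast hM
    linarith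
  by_cases h25 : N < 25
  · exact step 2 1 25 (le_primeCounting_of 2 1 (by decide)) (by omega) h25 (by norm_num)
  by_cases h225 : N < 225
  · exact step 23 9 225 (le_primeCounting_of 23 9 (by decide)) (by omega) h225 (by norm_num)
  by_cases h1200 : N < 1200
  · exact step 223 48 1200 (le_primeCounting_of 223 48 (by decide)) (by omega) h1200 (by norm_num)
  by_cases h4900 : N < 4900
  · exact step 1198 196 4900 (le_primeCounting_of 1198 196 (by decide)) (by omega) h4900 (by norm_num)
  · exact step 4898 216 5400 (le_primeCounting_of 4898 216 (by decide)) (by omega) (by omega) (by norm_num)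

/-- `5395 ≤ N ≤ e^{25.9}`: `N/25 ≤ π(N − 2)` from Dusart alone. [folklore] -/
private theorem mid_range (hπ : PrimeCountingLower 5393) {N : ℕ} (h1 : 5395 ≤ N) (h2 : Real.log (N : ℝ) ≤ 25.9) :
    (1 / 25 : ℝ) * (N : ℝ) ≤ (Nat.primeCounting (N - 2) : ℝ) := by
  have hx := hπ (N - 2) (by omega)
  have hcast : ((N - 2 : ℕ) : ℝ) = (N : ℝ) - 2 := by
    rw [Nat.cast_sub (by omega)]; norm_num
  rw [hcast] at hx
  have hN : (5395 : ℝ) ≤ N := by exact_mod_cast h1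
  have hlogle : Real.log ((N : ℝ) - 2) ≤ Real.log (N : ℝ) := Real.log_le_log (by linarith) (by linarith)
  have hlogge : Real.log 5393 ≤ Real.log ((N : ℝ) - 2) := Real.log_le_log (by norm_num) (by linarith)
  have hpos : 0 < Real.log ((N : ℝ) - 2) - 1 := by linarith [two_lt_log_5393]
  rw [div_le_iff₀ hpos] at hx
  have hπ0 : (0 : ℝ) ≤ Nat.primeCounting (N - 2) := Nat.cast_nonneg _
  have : (Nat.primeCounting (N - 2) : ℝ) * (Real.log ((N : ℝ) - 2) - 1) ≤ (Nat.primeCounting (N - 2) : ℝ) * 24.9 :=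
    mul_le_mul_of_nonneg_left (by linarith) hπ0
  linarith

/-- `4 ≤ N < 2^20` (in fact `≤ e^{25.9}`): `N/25 ≤ #romanovSet N`, given (F2). [folklore] -/
private theorem finite_range (hπ : PrimeCountingLower 5393) {N : ℕ} (h4 : 4 ≤ N) (hlog : Real.log (N : ℝ) ≤ 25.9) :
    (1 / 25 : ℝ) * (N : ℝ) ≤ ((romanovSet N).card : ℝ) := by
  have hR : (Nat.primeCounting (N - 2) : ℝ) ≤ ((romanovSet N).card : ℝ) := by
    exact_mod_cast primeCounting_le_card_romanovSet N
  by_cases h1 : N < 5395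
  · exact (small_range h4 h1).trans hR
  · exact (mid_range hπ (by omega) hlog).trans hR

/-- `N < 2^20 ⇒ log N ≤ 25.9`. [folklore] -/
private lemma log_le_of_lt_two_pow_20 {N : ℕ} (h4 : 4 ≤ N) (h : N < 2 ^ 20) : Real.log (N : ℝ) ≤ 25.9 := by
  have h1 : (N : ℝ) ≤ 2 ^ 20 := by exact_mod_cast h.le
  have hNpos : (0 : ℝ) < N := by exact_mod_cast (show 0 < N by omega)
  have h2 := Real.log_le_log hNpos h1
  rw [Real.log_pow] at h2
  norm_num at h2
  linarith [Real.log_two_lt_d9]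

/-- `N < 2^20 ⇒ log N ≤ 13.87`. [folklore] -/
private lemma log_le_1387_of_lt_two_pow_20 {N : ℕ} (h4 : 4 ≤ N) (h : N < 2 ^ 20) : Real.log (N : ℝ) ≤ 13.87 := by
  have h1 : (N : ℝ) ≤ 2 ^ 20 := by exact_mod_cast h.le
  have hNpos : (0 : ℝ) < N := by exact_mod_cast (show 0 < N by omega)
  have h2 := Real.log_le_log hNpos h1
  rw [Real.log_pow] at h2
  norm_num at h2
  linarith [Real.log_two_lt_d9]

/-! ## §6 The headline -/

/-- **The headline, abstract form (Dusart-shaped `π` input).** ANY uniform pair sieve with `A ≤ 10.5627` valid from some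
`x₀ ≤ e^{25.9}` on, and `π(n) ≥ n/(log n − 1)` for `n ≥ 5393` (the shape of Dusart 2010, Thm 6.9), give `N/25 ≤ #romanovSet N`
for all `N ≥ 4`. [cite: Nathanson1996, §7.6 Theorem 7.11 (Romanov's theorem) — explicit-uniform form proved here] [cite: Dusart2010, Theorem 6.9] -/
theorem headline_of_uniformPairSieve {A x₀ : ℝ} (hA : 0 ≤ A) (hA' : A ≤ 10.5627)
    (hPS : UniformPairSieve A x₀) (hπ : PrimeCountingLower 5393) (hx₀ : x₀ ≤ Real.exp 25.9) :
    RomanoffAllN (1 / 25 : ℝ) 4 := by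
  intro N hN
  by_cases h2 : N < 2 ^ 20
  · exact finite_range hπ hN (log_le_of_lt_two_pow_20 hN h2)
  by_cases h3 : (N : ℝ) < x₀
  · have hNpos : (0 : ℝ) < N := by exact_mod_cast (show 0 < N by omega)
    have hlog : Real.log (N : ℝ) ≤ 25.9 := by
      have := Real.log_le_log hNpos (h3.le.trans hx₀)
      rwa [Real.log_exp] at this
    exact finite_range hπ hN hlog
  · rw [not_lt] at h3
    exact density_ge hA hA' hPS hπ h3 (by omega)


/-! ## §7 The headline from IN-TREE named facts only: Riesel–Vaughan 1983 Lemma 5 + Rosser–Schoenfeld 1962 (3.3)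

Both inputs are registered Literature facts (`RieselVaughan1983_lemma5`, `RosserSchoenfeld1962_theorem2`), so this
version of the headline introduces NO new named fact.  The pair sieve is then available only from `x ≥ e^{24}`, which the
one-shift range `π(N − 2) ≥ N/25` (valid up to `log N ≤ 25.4` with (3.3)) covers; the weaker `π(x) > x/(log x − ½)` costs
`s = 1.34` instead of `1.398` (`c = 1.34²/(1.34 + 42.62) = 0.0408 ≥ 1/25`). -/

/-- The SHAPE of a `π`-lower bound `n/(log n − a) ≤ π(n)` for `n ≥ x₁` (`a`, `x₁` parameters; Rosser–Schoenfeld (3.3) is the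
instance `a = ½`, `x₁ = 67`, see `primeCountingLowerWith_of_RS`). [cite: RosserSchoenfeld1962, Theorem 2, eq. (3.3) (shape)] -/
def PrimeCountingLowerWith (a : ℝ) (x₁ : ℕ) : Prop :=
  ∀ n : ℕ, x₁ ≤ n → (n : ℝ) / (Real.log (n : ℝ) - a) ≤ (Nat.primeCounting n : ℝ)

/-- `log 67 > 2`. [folklore] -/
private lemma two_lt_log_67 : (2 : ℝ) < Real.log 67 := by
  have h1 : Real.exp 2 < 67 := by
    have he := Real.exp_one_lt_d9
    have h : Real.exp 2 = Real.exp 1 * Real.exp 1 := by rw [← Real.exp_add]; norm_num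
    rw [h]; nlinarith [Real.exp_pos 1]
  have h2 := Real.log_lt_log (Real.exp_pos 2) h1
  rwa [Real.log_exp] at h2

/-- Rosser–Schoenfeld (3.3) in the shape used here: `PrimeCountingLowerWith (1/2) 67`.
[cite: RosserSchoenfeld1962, Theorem 2, eq. (3.3)] -/
theorem primeCountingLowerWith_of_RS (h : Literature.NumberTheory.LFunctions.RosserSchoenfeld1962_theorem2) :
    PrimeCountingLowerWith (1 / 2) 67 := fun _ hn =>
  (Literature.NumberTheory.LFunctions.RosserSchoenfeld1962_eq_3_3_nat_of h hn).le

/-- **First moment, general final form** from a `π`-lower bound `n/(log n − a) ≤ π(n)` (`n ≥ x₁`, `log x₁ > a + 1`):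
for `N ≥ 2x₁`, `S₁(N)·(log N − a) ≥ N (log N/log 2 − 2) − x₁` (only the top shift can fall short of `x₁`).
[cite: Nathanson1996, §7.6 Lemma 7.10 (first moment; explicit form proved here)] -/
theorem M1_ge_with {a : ℝ} {x₁ : ℕ} (hx₁ : a + 1 < Real.log (x₁ : ℝ)) (hx₁2 : 2 ≤ x₁)
    (hπ : PrimeCountingLowerWith a x₁) {N : ℕ} (hN : 2 * x₁ ≤ N) :
    (N : ℝ) * (Real.log (N : ℝ) / Real.log 2 - 2) - x₁ ≤ M1 N * (Real.log (N : ℝ) - a) := by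
  set K := Nat.log 2 N with hK
  set L := Real.log (N : ℝ) with hL
  have hNpos : (0 : ℝ) < N := by exact_mod_cast (show 0 < N by omega)
  have hK1 : 1 ≤ K := Nat.le_log_of_pow_le (by norm_num) (by omega)
  have hpowK : 2 ^ K ≤ N := Nat.pow_log_le_self 2 (by omega)
  -- `log x₁ > a + 1`, so `log x − a > 1` for `x ≥ x₁`
  have hx₁pos : (0 : ℝ) < x₁ := by exact_mod_cast (show 0 < x₁ by omega)
  have hL1 : 1 < L - a := by
    have : Real.log (x₁ : ℝ) ≤ L := Real.log_le_log hx₁pos (by exact_mod_cast (show x₁ ≤ N by omega))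
    linarith
  -- per-shift bound: `π(N − 2^k)(L − a) ≥ N − 2^k − [k = K]·x₁`
  have hshift : ∀ k ∈ Icc 1 K, ((N : ℝ) - (2 : ℝ) ^ k) - (if k = K then (x₁ : ℝ) else 0)
      ≤ (Nat.primeCounting (N - 2 ^ k) : ℝ) * (L - a) := by
    intro k hk
    rw [mem_Icc] at hk
    have hpowk : 2 ^ k ≤ N := (Nat.pow_le_pow_right (by norm_num) hk.2).trans hpowK
    have hcast : ((N - 2 ^ k : ℕ) : ℝ) = (N : ℝ) - (2 : ℝ) ^ k := by
      rw [Nat.cast_sub hpowk]; push_cast; ring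
    by_cases hbig : x₁ ≤ N - 2 ^ k
    · -- the `π` bound applies at `x = N − 2^k`
      have hx := hπ (N - 2 ^ k) hbig
      have hxpos : (0 : ℝ) < ((N - 2 ^ k : ℕ) : ℝ) := by exact_mod_cast (show 0 < N - 2 ^ k by omega)
      have hlogx1 : 1 < Real.log ((N - 2 ^ k : ℕ) : ℝ) - a := by
        have : Real.log (x₁ : ℝ) ≤ Real.log ((N - 2 ^ k : ℕ) : ℝ) :=
          Real.log_le_log hx₁pos (by exact_mod_cast hbig)
        linarith
      have hlogxL : Real.log ((N - 2 ^ k : ℕ) : ℝ) - a ≤ L - a := by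
        have : Real.log ((N - 2 ^ k : ℕ) : ℝ) ≤ L := Real.log_le_log hxpos (by rw [hcast]; linarith [pow_pos (show (0:ℝ) < 2 by norm_num) k])
        linarith
      rw [div_le_iff₀ (by linarith)] at hx
      -- `x ≤ π(x)(log x − a) ≤ π(x)(L − a)`
      have hπ0 : (0 : ℝ) ≤ Nat.primeCounting (N - 2 ^ k) := Nat.cast_nonneg _
      have : ((N - 2 ^ k : ℕ) : ℝ) ≤ (Nat.primeCounting (N - 2 ^ k) : ℝ) * (L - a) :=
        hx.trans (mul_le_mul_of_nonneg_left hlogxL hπ0)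
      rw [hcast] at this
      have hc : (0 : ℝ) ≤ (if k = K then (x₁ : ℝ) else 0) := by split_ifs <;> positivity
      linarith
    · -- only the top shift can be short, and then the claim is `≤ 0 ≤ π·(L−1)`
      have hkK : k = K := by
        by_contra hne
        have hlt : k < K := lt_of_le_of_ne hk.2 hne
        have : 2 ^ (k + 1) ≤ 2 ^ K := Nat.pow_le_pow_right (by norm_num) hlt
        rw [pow_succ] at this
        omega
      rw [if_pos hkK]
      have hπ0 : (0 : ℝ) ≤ (Nat.primeCounting (N - 2 ^ k) : ℝ) * (L - a) :=
        mul_nonneg (Nat.cast_nonneg _) (by linarith)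
      have : (N : ℝ) - (2 : ℝ) ^ k < x₁ := by
        have h' : ((N - 2 ^ k : ℕ) : ℝ) < x₁ := by exact_mod_cast (show N - 2 ^ k < x₁ by omega)
        rw [hcast] at h'; exact h'
      linarith
  have hsum := sum_le_sum hshift
  rw [sum_sub_distrib, sum_sub_distrib, sum_const, Nat.card_Icc, sum_two_pow_Icc, sum_ite_eq',
    if_pos (mem_Icc.mpr ⟨hK1, le_rfl⟩), ← sum_mul] at hsum
  simp only [add_tsub_cancel_right, nsmul_eq_mul] at hsum
  have hmain := natlog_main N (by omega)
  have hM1 := M1_ge N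
  have hM1' : (∑ k ∈ Icc 1 K, (Nat.primeCounting (N - 2 ^ k) : ℝ)) * (L - a) ≤ M1 N * (L - a) :=
    mul_le_mul_of_nonneg_right hM1 (by linarith)
  linarith


/-- **The analytic branch with Rosser–Schoenfeld (3.3).** A uniform pair sieve with `A ≤ 10.5627` from `x₀` on,
`π(n) ≥ n/(log n − ½)` (`n ≥ 67`) and `N ≥ max(x₀, 2^20)` give `#romanovSet N ≥ N/25` (`s = 1.34`, `B = 42.62`).
[cite: Nathanson1996, §7.6 Theorem 7.11 (Romanov's theorem) — explicit form proved here] -/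
theorem density_ge_RS {A x₀ : ℝ} (hA : 0 ≤ A) (hA' : A ≤ 10.5627) (hPS : UniformPairSieve A x₀)
    (hπ : PrimeCountingLowerWith (1 / 2) 67) {N : ℕ} (hx : x₀ ≤ (N : ℝ)) (hN : 2 ^ 20 ≤ N) :
    (1 / 25 : ℝ) * (N : ℝ) ≤ ((romanovSet N).card : ℝ) := by
  have hN' : (1048576 : ℝ) ≤ N := by exact_mod_cast (show 1048576 ≤ N by norm_num at hN; omega)
  have hlog2lo : (0.6931471803 : ℝ) < Real.log 2 := Real.log_two_gt_d9
  have hlog2hi : Real.log 2 < 0.6931471808 := Real.log_two_lt_d9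
  set L := Real.log (N : ℝ) with hL
  have hL : 20 * Real.log 2 ≤ L := by
    have h := Real.log_le_log (by positivity) (show ((2 : ℝ) ^ 20) ≤ (N : ℝ) by exact_mod_cast hN)
    rw [Real.log_pow] at h
    norm_num at h
    rw [hL]; exact h
  have hL' : (13.86294 : ℝ) ≤ L := by linarith
  -- first moment: `M1 ≥ 1.34 N`
  have h1 := M1_ge_with (a := 1 / 2) (x₁ := 67) (by have := two_lt_log_67; push_cast; linarith)
    (by norm_num) hπ (N := N) (by norm_num at hN; omega)
  have hinv : (1.4426 : ℝ) * L ≤ L / Real.log 2 := by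
    rw [le_div_iff₀ (by linarith)]; nlinarith
  have hM1 : (1.34 : ℝ) * N ≤ M1 N := by
    have hL1 : 0 < L - 1 / 2 := by linarith
    have hkey : (1.34 : ℝ) * N * (L - 1 / 2) ≤ (N : ℝ) * (L / Real.log 2 - 2) - (67 : ℕ) := by
      have : (N : ℝ) * (1.4426 * L) ≤ (N : ℝ) * (L / Real.log 2) := mul_le_mul_of_nonneg_left hinv (by linarith)
      push_cast
      nlinarith [mul_le_mul_of_nonneg_left hL' (show (0:ℝ) ≤ N by linarith)]
    exact le_of_mul_le_mul_right (hkey.trans h1) hL1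
  -- second moment: `M2 ≤ M1 + 42.62 N`
  have h2 := M2_le_final hA hPS powTwoShiftMeanLe_193841 hx (by norm_num at hN; omega)
  have hB : A * 1.93841 / Real.log 2 ^ 2 ≤ 42.62 := by
    rw [div_le_iff₀ (by positivity)]
    nlinarith
  have hM2 : M2 N ≤ M1 N + 42.62 * (N : ℝ) := by
    have : A * 1.93841 / Real.log 2 ^ 2 * (N : ℝ) ≤ 42.62 * (N : ℝ) :=
      mul_le_mul_of_nonneg_right hB (by linarith)
    linarith
  have h3 := density_of_moments (by norm_num) (by norm_num) hM1 hM2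
  have hc : (1 / 25 : ℝ) ≤ (1.34 : ℝ) ^ 2 / (1.34 + 42.62) := by norm_num
  calc (1 / 25 : ℝ) * N ≤ (1.34 : ℝ) ^ 2 / (1.34 + 42.62) * N := mul_le_mul_of_nonneg_right hc (by linarith)
    _ ≤ _ := h3

/-- **The analytic branch for ANY pair-sieve constant `A`** (the plug-in point for sharper all-`x` sieve constants): a uniform
pair sieve with constant `A ≥ 0` from `x₀` on and Rosser–Schoenfeld (3.3) give, for `N ≥ max(x₀, 2^20)`,
`#romanovSet N ≥ 1.34²/(1.34 + 4.035·A) · N` (`4.035 ≥ R₀/log²2`; `A = 16C₂ ↦ 0.0408`, `A = 8C₂ ↦ 0.079`, `A = 2C₂ ↦ 0.27`).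
[cite: Nathanson1996, §7.6 Theorem 7.11 (Romanov's theorem) — explicit form proved here, pair-sieve constant as a parameter] -/
theorem density_general {A x₀ : ℝ} (hA : 0 ≤ A) (hPS : UniformPairSieve A x₀)
    (hπ : PrimeCountingLowerWith (1 / 2) 67) {N : ℕ} (hx : x₀ ≤ (N : ℝ)) (hN : 2 ^ 20 ≤ N) :
    (1.34 : ℝ) ^ 2 / (1.34 + 4.035 * A) * (N : ℝ) ≤ ((romanovSet N).card : ℝ) := by
  have hN' : (1048576 : ℝ) ≤ N := by exact_mod_cast (show 1048576 ≤ N by norm_num at hN; omega)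
  have hlog2lo : (0.6931471803 : ℝ) < Real.log 2 := Real.log_two_gt_d9
  have hlog2hi : Real.log 2 < 0.6931471808 := Real.log_two_lt_d9
  set L := Real.log (N : ℝ) with hL
  have hL : 20 * Real.log 2 ≤ L := by
    have h := Real.log_le_log (by positivity) (show ((2 : ℝ) ^ 20) ≤ (N : ℝ) by exact_mod_cast hN)
    rw [Real.log_pow] at h
    norm_num at h
    rw [hL]; exact h
  have hL' : (13.86294 : ℝ) ≤ L := by linarith
  have h1 := M1_ge_with (a := 1 / 2) (x₁ := 67) (by have := two_lt_log_67; push_cast; linarith)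
    (by norm_num) hπ (N := N) (by norm_num at hN; omega)
  have hinv : (1.4426 : ℝ) * L ≤ L / Real.log 2 := by
    rw [le_div_iff₀ (by linarith)]; nlinarith
  have hM1 : (1.34 : ℝ) * N ≤ M1 N := by
    have hL1 : 0 < L - 1 / 2 := by linarith
    have hkey : (1.34 : ℝ) * N * (L - 1 / 2) ≤ (N : ℝ) * (L / Real.log 2 - 2) - (67 : ℕ) := by
      have : (N : ℝ) * (1.4426 * L) ≤ (N : ℝ) * (L / Real.log 2) := mul_le_mul_of_nonneg_left hinv (by linarith)
      push_cast
      nlinarith [mul_le_mul_of_nonneg_left hL' (show (0:ℝ) ≤ N by linarith)]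
    exact le_of_mul_le_mul_right (hkey.trans h1) hL1
  have h2 := M2_le_final hA hPS powTwoShiftMeanLe_193841 hx (by norm_num at hN; omega)
  have hB : A * 1.93841 / Real.log 2 ^ 2 ≤ 4.035 * A := by
    rw [div_le_iff₀ (by positivity)]
    have hsq : (0.48045 : ℝ) ≤ Real.log 2 ^ 2 := by nlinarith
    nlinarith [mul_le_mul_of_nonneg_left hsq hA]
  have hM2 : M2 N ≤ M1 N + 4.035 * A * (N : ℝ) := by
    have : A * 1.93841 / Real.log 2 ^ 2 * (N : ℝ) ≤ 4.035 * A * (N : ℝ) :=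
      mul_le_mul_of_nonneg_right hB (by linarith)
    linarith
  exact density_of_moments (by norm_num) (by positivity) hM1 hM2

/-- `5395 ≤ N ≤ e^{25.4}`: `N/25 ≤ π(N − 2)` from Rosser–Schoenfeld (3.3) alone. [folklore] -/
private theorem mid_range_RS (hπ : PrimeCountingLowerWith (1 / 2) 67) {N : ℕ} (h1 : 5395 ≤ N)
    (h2 : Real.log (N : ℝ) ≤ 25.4) :
    (1 / 25 : ℝ) * (N : ℝ) ≤ (Nat.primeCounting (N - 2) : ℝ) := by
  have hx := hπ (N - 2) (by omega)
  have hcast : ((N - 2 : ℕ) : ℝ) = (N : ℝ) - 2 := by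
    rw [Nat.cast_sub (by omega)]; norm_num
  rw [hcast] at hx
  have hN : (5395 : ℝ) ≤ N := by exact_mod_cast h1
  have hlogle : Real.log ((N : ℝ) - 2) ≤ Real.log (N : ℝ) := Real.log_le_log (by linarith) (by linarith)
  have hlogge : Real.log 67 ≤ Real.log ((N : ℝ) - 2) := Real.log_le_log (by norm_num) (by linarith)
  have hpos : 0 < Real.log ((N : ℝ) - 2) - 1 / 2 := by linarith [two_lt_log_67]
  rw [div_le_iff₀ hpos] at hx
  have hπ0 : (0 : ℝ) ≤ Nat.primeCounting (N - 2) := Nat.cast_nonneg _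
  have : (Nat.primeCounting (N - 2) : ℝ) * (Real.log ((N : ℝ) - 2) - 1 / 2) ≤ (Nat.primeCounting (N - 2) : ℝ) * 24.9 :=
    mul_le_mul_of_nonneg_left (by linarith) hπ0
  linarith

/-- `4 ≤ N ≤ e^{25.4}`: `N/25 ≤ #romanovSet N`, given Rosser–Schoenfeld (3.3). [folklore] -/
private theorem finite_range_RS (hπ : PrimeCountingLowerWith (1 / 2) 67) {N : ℕ} (h4 : 4 ≤ N)
    (hlog : Real.log (N : ℝ) ≤ 25.4) :
    (1 / 25 : ℝ) * (N : ℝ) ≤ ((romanovSet N).card : ℝ) := by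
  have hR : (Nat.primeCounting (N - 2) : ℝ) ≤ ((romanovSet N).card : ℝ) := by
    exact_mod_cast primeCounting_le_card_romanovSet N
  by_cases h1 : N < 5395
  · exact (small_range h4 h1).trans hR
  · exact (mid_range_RS hπ (by omega) hlog).trans hR

/-- The headline from ANY uniform pair sieve with `A ≤ 10.5627` valid from some `x₀ ≤ e^{25.4}` on and
Rosser–Schoenfeld (3.3): `N/25 ≤ #romanovSet N` for all `N ≥ 4`.
[cite: Nathanson1996, §7.6 Theorem 7.11 (Romanov's theorem) — explicit-uniform form proved here] [cite: RosserSchoenfeld1962, Theorem 2, eq. (3.3)] -/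
theorem headline_of_uniformPairSieve_RS {A x₀ : ℝ} (hA : 0 ≤ A) (hA' : A ≤ 10.5627)
    (hPS : UniformPairSieve A x₀) (hπ : PrimeCountingLowerWith (1 / 2) 67) (hx₀ : x₀ ≤ Real.exp 25.4) :
    RomanoffAllN (1 / 25 : ℝ) 4 := by
  intro N hN
  by_cases h2 : N < 2 ^ 20
  · exact finite_range_RS hπ hN (by linarith [log_le_1387_of_lt_two_pow_20 hN h2])
  by_cases h3 : (N : ℝ) < x₀
  · have hNpos : (0 : ℝ) < N := by exact_mod_cast (show 0 < N by omega)
    have hlog : Real.log (N : ℝ) ≤ 25.4 := by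
      have := Real.log_le_log hNpos (h3.le.trans hx₀)
      rwa [Real.log_exp] at this
    exact finite_range_RS hπ hN hlog
  · rw [not_lt] at h3
    exact density_ge_RS hA hA' hPS hπ h3 (by omega)

/-- `pairCount x h` is at most Riesel–Vaughan's interval count on `[0, x]` with `(a, b) = (1, h)`. [folklore] -/
private theorem pairCount_le_shiftedPrimePairCount (x h : ℕ) :
    pairCount x h ≤ RieselVaughan1983.shiftedPrimePairCount (x : ℝ) 0 1 (h : ℤ) := by
  unfold pairCount RieselVaughan1983.shiftedPrimePairCount
  rw [← Set.ncard_coe_finset]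
  refine Set.ncard_le_ncard ?_ (RieselVaughan1983.shiftedPrimePairCount_finite _ _ _ _)
  intro p hp
  rw [mem_coe, mem_filter, Nat.mem_primesLE] at hp
  refine ⟨hp.1.2, ⟨p + h, hp.2, by push_cast; ring⟩, by exact_mod_cast (Nat.zero_le p), ?_⟩
  simpa using (show (p : ℝ) ≤ x by exact_mod_cast hp.1.1)

/-- Riesel–Vaughan's Lemma 5 (first table row) is a `UniformPairSieve` with `A = 16·C₂` from `x₀ = e^{24}` on.
[cite: RieselVaughan1983, Lemma 5] -/
theorem uniformPairSieve_of_RV (hRV : RieselVaughan1983_lemma5) :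
    UniformPairSieve (16 * twinPrimeConst) (Real.exp 24) := by
  intro x h hx hh _
  have hcount := RieselVaughan1983_lemma5.primePairs hRV hx (h := (h : ℤ)) (by exact_mod_cast hh) 0
  have hle : (pairCount x h : ℝ) ≤ (RieselVaughan1983.shiftedPrimePairCount (x : ℝ) 0 1 (h : ℤ) : ℝ) := by
    exact_mod_cast pairCount_le_shiftedPrimePairCount x h
  have hprod : (∏ p ∈ (h : ℤ).natAbs.primeFactors.filter (fun p => 2 < p), (((p : ℝ) - 1) / ((p : ℝ) - 2)))
      = oddSingularFactor h := by
    rw [Int.natAbs_natCast]; rfl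
  rw [hprod] at hcount
  have hxpos : (0 : ℝ) < x := lt_of_lt_of_le (Real.exp_pos 24) hx
  have hlogpos : 0 < Real.log (x : ℝ) := by
    have : (24 : ℝ) ≤ Real.log x := by
      have := Real.log_le_log (Real.exp_pos 24) hx
      rwa [Real.log_exp] at this
    linarith
  have hf : 0 ≤ oddSingularFactor h := by
    unfold oddSingularFactor
    refine Finset.prod_nonneg fun p hp => ?_
    have hp2 : (2 : ℝ) < p := by exact_mod_cast (Finset.mem_filter.mp hp).2
    exact div_nonneg (by linarith) (by linarith)
  have hmain : (8 * (2 * twinPrimeConst) * (x : ℝ) / (Real.log x * (0 + Real.log x)) - 100 * Real.sqrt x)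
      * oddSingularFactor h ≤ 16 * twinPrimeConst * oddSingularFactor h * (x : ℝ) / Real.log (x : ℝ) ^ 2 := by
    have hs : 0 ≤ 100 * Real.sqrt (x : ℝ) := by positivity
    have heq : 8 * (2 * twinPrimeConst) * (x : ℝ) / (Real.log x * (0 + Real.log x)) * oddSingularFactor h
        = 16 * twinPrimeConst * oddSingularFactor h * (x : ℝ) / Real.log (x : ℝ) ^ 2 := by
      rw [zero_add, ← sq]; ring
    have hsplit : (8 * (2 * twinPrimeConst) * (x : ℝ) / (Real.log x * (0 + Real.log x)) - 100 * Real.sqrt x)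
        * oddSingularFactor h = 8 * (2 * twinPrimeConst) * (x : ℝ) / (Real.log x * (0 + Real.log x))
        * oddSingularFactor h - 100 * Real.sqrt x * oddSingularFactor h := by ring
    rw [hsplit, heq]
    linarith [mul_nonneg hs hf]
  linarith

/-- **HEADLINE from in-tree named facts.** Riesel–Vaughan 1983 Lemma 5 and Rosser–Schoenfeld 1962 (3.3) give
**`#{n ≤ N : n = p + 2^k, k ≥ 1} ≥ N/25` for every `N ≥ 4`** — no new named fact is introduced.
[cite: Nathanson1996, §7.6 Theorem 7.11 (Romanov's theorem) — explicit-uniform form `c = 1/25`, `N₁ = 4` proved here] [cite: RieselVaughan1983, Lemma 5]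
[cite: RosserSchoenfeld1962, Theorem 2, eq. (3.3)] -/
theorem headline_of_RV_RS (hRV : RieselVaughan1983_lemma5)
    (hRS : Literature.NumberTheory.LFunctions.RosserSchoenfeld1962_theorem2) : RomanoffAllN (1 / 25 : ℝ) 4 := by
  have hC := twinPrimeConst_le_0660166
  have hC0 : 0 < twinPrimeConst := twinPrimeConst_pos_holds
  exact headline_of_uniformPairSieve_RS (A := 16 * twinPrimeConst) (x₀ := Real.exp 24) (by positivity) (by nlinarith)
    (uniformPairSieve_of_RV hRV) (primeCountingLowerWith_of_RS hRS) (Real.exp_le_exp.mpr (by norm_num))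

/-! ## §8 (appended) The headline from Rosser–Schoenfeld (3.3) ALONE: the pair sieve is now the PROVED
`TwoResidueSelbergExplicit.pairCount_le_explicit` (`A = 20.8` from `e^{47}`), price `1/25 → 1/48`

Cell parity-ideate seat p5 g17, ROUND-22 PART C (`round22/RomanoffAllN_RS.lean`); ported by parity-ideate-lit g30. -/

/-- **The uniform pair sieve with `A = 20.8` from `x₀ = e^{47}` on is a THEOREM** (the explicit two-residue
large sieve of `TwoResidueSelbergSumExplicit.lean`), replacing the named fact `RieselVaughan1983_lemma5`
(`A = 16C₂`, `x₀ = e^{24}`) at the cost of the constant.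
[cite: BatemanDiamond2004, Thm 13.8 (explicit form, proved in `TwoResidueSelbergSumExplicit`)] [cite: RieselVaughan1983, Lemma 5 (printed h-uniform bound; weaker constant proved)] -/
theorem uniformPairSieve_explicit : UniformPairSieve 20.8 (Real.exp 47) := by
  intro x h hx hh heven
  exact TwoResidueSelbergExplicit.pairCount_le_explicit hx hh heven

/-- `5395 ≤ N ≤ e^{47}`: `N/48 ≤ π(N − 2)` from Rosser–Schoenfeld (3.3) alone
(`(N−2)/(log(N−2) − ½) ≥ (N−2)/46.5 ≥ N/48` iff `N ≥ 64`). [folklore] -/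
private theorem mid_range_RS_48 (hπ : PrimeCountingLowerWith (1 / 2) 67) {N : ℕ} (h1 : 5395 ≤ N)
    (h2 : Real.log (N : ℝ) ≤ 47) :
    (1 / 48 : ℝ) * (N : ℝ) ≤ (Nat.primeCounting (N - 2) : ℝ) := by
  have hx := hπ (N - 2) (by omega)
  have hcast : ((N - 2 : ℕ) : ℝ) = (N : ℝ) - 2 := by
    rw [Nat.cast_sub (by omega)]; norm_num
  rw [hcast] at hx
  have hN : (5395 : ℝ) ≤ N := by exact_mod_cast h1
  have hlogle : Real.log ((N : ℝ) - 2) ≤ Real.log (N : ℝ) := Real.log_le_log (by linarith) (by linarith)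
  have hlogge : Real.log 67 ≤ Real.log ((N : ℝ) - 2) := Real.log_le_log (by norm_num) (by linarith)
  have hpos : 0 < Real.log ((N : ℝ) - 2) - 1 / 2 := by linarith [two_lt_log_67]
  rw [div_le_iff₀ hpos] at hx
  have hπ0 : (0 : ℝ) ≤ Nat.primeCounting (N - 2) := Nat.cast_nonneg _
  have : (Nat.primeCounting (N - 2) : ℝ) * (Real.log ((N : ℝ) - 2) - 1 / 2)
      ≤ (Nat.primeCounting (N - 2) : ℝ) * 46.5 :=
    mul_le_mul_of_nonneg_left (by linarith) hπ0
  linarith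

/-- `4 ≤ N ≤ e^{47}`: `N/48 ≤ #romanovSet N`, given Rosser–Schoenfeld (3.3) (kernel certificate below
`5395`, one shift above). [folklore] -/
private theorem finite_range_RS_48 (hπ : PrimeCountingLowerWith (1 / 2) 67) {N : ℕ} (h4 : 4 ≤ N)
    (hlog : Real.log (N : ℝ) ≤ 47) :
    (1 / 48 : ℝ) * (N : ℝ) ≤ ((romanovSet N).card : ℝ) := by
  have hR : (Nat.primeCounting (N - 2) : ℝ) ≤ ((romanovSet N).card : ℝ) := by
    exact_mod_cast primeCounting_le_card_romanovSet N
  by_cases h1 : N < 5395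
  · have hs := small_range h4 h1
    have hN0 : (0 : ℝ) ≤ N := Nat.cast_nonneg N
    linarith
  · exact (mid_range_RS_48 hπ (by omega) hlog).trans hR

/-- `2^20 ≤ e^{47}`. [folklore] -/
private theorem two_pow_20_le_exp_47 : (2 : ℝ) ^ 20 ≤ Real.exp 47 := by
  have he : (2 : ℝ) ≤ Real.exp 1 := by have := Real.exp_one_gt_d9; linarith
  have h47 : (2 : ℝ) ^ 47 ≤ Real.exp 47 := by
    rw [show (47 : ℝ) = ((47 : ℕ) : ℝ) * 1 by norm_num, Real.exp_nat_mul]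
    exact pow_le_pow_left₀ (by norm_num) he 47
  exact le_trans (by norm_num) h47

/-- **Romanoff's theorem for ALL `N ≥ 4` with an explicit constant, from Rosser–Schoenfeld (3.3) ALONE:
`#{n ≤ N : n = p + 2^k, k ≥ 1} ≥ N/48`.**  The pair sieve is the PROVED `TwoResidueSelbergExplicit.pairCount_le_explicit`
(`A = 20.8`, `x₀ = e^{47}`, via `density_general`: `1.34²/(1.34 + 4.035·20.8) = 0.02106 ≥ 1/48`); below `e^{47}` one shift
`p + 2` and (3.3) suffice; the `2^k`-column inputs are the tree's kernel certificates (`powTwoShiftMeanLe_193841`).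
ONE named fact (`RosserSchoenfeld1962_theorem2`) instead of the two of `headline_of_RV_RS`; price `1/25 → 1/48`.
[cite: Nathanson1996, §7.6 Theorem 7.11 (Romanov's theorem) — explicit-uniform form `c = 1/48`, `N₁ = 4` proved here]
[cite: RosserSchoenfeld1962, Theorem 2, eq. (3.3)] [cite: BatemanDiamond2004, Thm 13.8 (explicit form)] -/
theorem romanoffAllN_of_RS
    (hRS : Literature.NumberTheory.LFunctions.RosserSchoenfeld1962_theorem2) :
    RomanoffAllN (1 / 48 : ℝ) 4 := by
  have hπ := primeCountingLowerWith_of_RS hRS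
  intro N hN
  by_cases h3 : (N : ℝ) < Real.exp 47
  · have hNpos : (0 : ℝ) < N := by exact_mod_cast (show 0 < N by omega)
    have hlog : Real.log (N : ℝ) ≤ 47 := by
      have := Real.log_le_log hNpos h3.le
      rwa [Real.log_exp] at this
    exact finite_range_RS_48 hπ hN hlog
  · rw [not_lt] at h3
    have h20 : 2 ^ 20 ≤ N := by
      have : (2 : ℝ) ^ 20 ≤ (N : ℝ) := two_pow_20_le_exp_47.trans h3
      exact_mod_cast this
    have hd := density_general (A := 20.8) (x₀ := Real.exp 47) (by norm_num)
      uniformPairSieve_explicit hπ h3 h20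
    have hc : (1 / 48 : ℝ) ≤ (1.34 : ℝ) ^ 2 / (1.34 + 4.035 * 20.8) := by norm_num
    have hN0 : (0 : ℝ) ≤ N := Nat.cast_nonneg N
    exact (mul_le_mul_of_nonneg_right hc hN0).trans hd

/-- The same as a closed implication over the tree's registered fact, with `RomanoffAllN` unfolded:
`RosserSchoenfeld1962_theorem2 → ∀ N ≥ 4, N/48 ≤ #romanovSet N`.
[cite: Nathanson1996, §7.6 Theorem 7.11 (Romanov's theorem) — explicit-uniform form proved here] [cite: RosserSchoenfeld1962, Theorem 2, eq. (3.3)] -/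
theorem romanoffAllN_of_RS_statement :
    Literature.NumberTheory.LFunctions.RosserSchoenfeld1962_theorem2 →
      ∀ N : ℕ, 4 ≤ N → (1 / 48 : ℝ) * (N : ℝ) ≤ ((romanovSet N).card : ℝ) :=
  fun hRS => romanoffAllN_of_RS hRS


/-! ## §9 (appended) The κ-refined headline from Rosser–Schoenfeld (3.3) ALONE: constant `1/41`, the pair sieve being
`TwoResidueSelbergExplicit.pairCount_le_kappa` (`A = 17.75` from `e^{41}`)

Cell parity-ideate seat p5 g17, ROUND-22 §9(a) V2 glue (`round22/RomanoffAllN_RS_V2.lean` sha16 2c9745acbbd4d4fb, from the marker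
`κ-refined glue (V2)`); ported by parity-ideate-lit g30. -/

/-- **The uniform pair sieve with `A = 17.75` from `x₀ = e^{41}` on is a THEOREM** (κ-refined explicit two-residue large
sieve, `TwoResidueSelbergExplicit.pairCount_le_kappa`).
[cite: BatemanDiamond2004, Thm 13.8 (explicit form, proved in `TwoResidueSelbergSumExplicit`)] [cite: RieselVaughan1983, Lemma 5 (printed h-uniform bound; weaker constant proved)] -/
theorem uniformPairSieve_kappa : UniformPairSieve 17.75 (Real.exp 41) := by
  intro x h hx hh heven
  exact TwoResidueSelbergExplicit.pairCount_le_kappa hx hh heven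

/-- `5395 ≤ N ≤ e^{41}`: `N/41 ≤ π(N − 2)` from Rosser–Schoenfeld (3.3)
(`(N−2)/40.5 ≥ N/41` iff `N ≥ 164`). [folklore] -/
private theorem mid_range_RS_41 (hπ : PrimeCountingLowerWith (1 / 2) 67) {N : ℕ} (h1 : 5395 ≤ N)
    (h2 : Real.log (N : ℝ) ≤ 41) :
    (1 / 41 : ℝ) * (N : ℝ) ≤ (Nat.primeCounting (N - 2) : ℝ) := by
  have hx := hπ (N - 2) (by omega)
  have hcast : ((N - 2 : ℕ) : ℝ) = (N : ℝ) - 2 := by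
    rw [Nat.cast_sub (by omega)]; norm_num
  rw [hcast] at hx
  have hN : (5395 : ℝ) ≤ N := by exact_mod_cast h1
  have hlogle : Real.log ((N : ℝ) - 2) ≤ Real.log (N : ℝ) := Real.log_le_log (by linarith) (by linarith)
  have hlogge : Real.log 67 ≤ Real.log ((N : ℝ) - 2) := Real.log_le_log (by norm_num) (by linarith)
  have hpos : 0 < Real.log ((N : ℝ) - 2) - 1 / 2 := by linarith [two_lt_log_67]
  rw [div_le_iff₀ hpos] at hx
  have hπ0 : (0 : ℝ) ≤ Nat.primeCounting (N - 2) := Nat.cast_nonneg _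
  have : (Nat.primeCounting (N - 2) : ℝ) * (Real.log ((N : ℝ) - 2) - 1 / 2)
      ≤ (Nat.primeCounting (N - 2) : ℝ) * 40.5 :=
    mul_le_mul_of_nonneg_left (by linarith) hπ0
  linarith

/-- `4 ≤ N ≤ e^{41}`: `N/41 ≤ #romanovSet N`, given Rosser–Schoenfeld (3.3). [folklore] -/
private theorem finite_range_RS_41 (hπ : PrimeCountingLowerWith (1 / 2) 67) {N : ℕ} (h4 : 4 ≤ N)
    (hlog : Real.log (N : ℝ) ≤ 41) :
    (1 / 41 : ℝ) * (N : ℝ) ≤ ((romanovSet N).card : ℝ) := by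
  have hR : (Nat.primeCounting (N - 2) : ℝ) ≤ ((romanovSet N).card : ℝ) := by
    exact_mod_cast primeCounting_le_card_romanovSet N
  by_cases h1 : N < 5395
  · have hs := small_range h4 h1
    have hN0 : (0 : ℝ) ≤ N := Nat.cast_nonneg N
    linarith
  · exact (mid_range_RS_41 hπ (by omega) hlog).trans hR

/-- `2^20 ≤ e^{41}`. [folklore] -/
private theorem two_pow_20_le_exp_41 : (2 : ℝ) ^ 20 ≤ Real.exp 41 := by
  have he : (2 : ℝ) ≤ Real.exp 1 := by have := Real.exp_one_gt_d9; linarith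
  have h41 : (2 : ℝ) ^ 41 ≤ Real.exp 41 := by
    rw [show (41 : ℝ) = ((41 : ℕ) : ℝ) * 1 by norm_num, Real.exp_nat_mul]
    exact pow_le_pow_left₀ (by norm_num) he 41
  exact le_trans (by norm_num) h41

/-- **Romanoff's theorem for ALL `N ≥ 4` from Rosser–Schoenfeld (3.3) ALONE with constant `1/41`:
`#{n ≤ N : n = p + 2^k, k ≥ 1} ≥ N/41`** (κ-refined: `1.34²/(1.34 + 4.035·17.75) = 0.02461 ≥ 1/41` above `e^{41}` via
`density_general` and `uniformPairSieve_kappa`; one shift `p + 2` and (3.3) on `[5395, e^{41}]`; kernel certificate below `5395`).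
Supersedes `romanoffAllN_of_RS` (`1/48`) with the same single named input.
[cite: Nathanson1996, §7.6 Theorem 7.11 (Romanov's theorem) — explicit-uniform form `c = 1/41`, `N₁ = 4` proved here]
[cite: RosserSchoenfeld1962, Theorem 2, eq. (3.3)] [cite: BatemanDiamond2004, Thm 13.8 (explicit form)] -/
theorem romanoffAllN_of_RS_kappa
    (hRS : Literature.NumberTheory.LFunctions.RosserSchoenfeld1962_theorem2) :
    RomanoffAllN (1 / 41 : ℝ) 4 := by
  have hπ := primeCountingLowerWith_of_RS hRS
  intro N hN
  by_cases h3 : (N : ℝ) < Real.exp 41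
  · have hNpos : (0 : ℝ) < N := by exact_mod_cast (show 0 < N by omega)
    have hlog : Real.log (N : ℝ) ≤ 41 := by
      have := Real.log_le_log hNpos h3.le
      rwa [Real.log_exp] at this
    exact finite_range_RS_41 hπ hN hlog
  · rw [not_lt] at h3
    have h20 : 2 ^ 20 ≤ N := by
      have : (2 : ℝ) ^ 20 ≤ (N : ℝ) := two_pow_20_le_exp_41.trans h3
      exact_mod_cast this
    have hd := density_general (A := 17.75) (x₀ := Real.exp 41) (by norm_num)
      uniformPairSieve_kappa hπ h3 h20
    have hc : (1 / 41 : ℝ) ≤ (1.34 : ℝ) ^ 2 / (1.34 + 4.035 * 17.75) := by norm_num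
    have hN0 : (0 : ℝ) ≤ N := Nat.cast_nonneg N
    exact (mul_le_mul_of_nonneg_right hc hN0).trans hd

/-- The κ-refined headline as a closed implication over the tree's registered fact, `RomanoffAllN` unfolded:
`RosserSchoenfeld1962_theorem2 → ∀ N ≥ 4, N/41 ≤ #romanovSet N`.
[cite: Nathanson1996, §7.6 Theorem 7.11 (Romanov's theorem) — explicit-uniform form proved here] [cite: RosserSchoenfeld1962, Theorem 2, eq. (3.3)] -/
theorem romanoffAllN_of_RS_kappa_statement :
    Literature.NumberTheory.LFunctions.RosserSchoenfeld1962_theorem2 →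
      ∀ N : ℕ, 4 ≤ N → (1 / 41 : ℝ) * (N : ℝ) ≤ ((romanovSet N).card : ℝ) :=
  fun hRS => romanoffAllN_of_RS_kappa hRS

/-! ### §10 (appended) UNCONDITIONAL: Chebyshev (Mathlib) in place of Rosser–Schoenfeld (3.3)

Cell parity-ideate seat p5, ROUND-22 PART D (`round22/RomanoffAllN_Unconditional.lean` 9fbd3bf0464892c0, lines 2927–3228),
statements and proofs verbatim; helper lemmas made `private`. The last registered named fact of §9 (`RosserSchoenfeld1962_theorem2`)
is replaced by Chebyshev's bound as PROVED in Mathlib (`Chebyshev.theta_ge'`, `Chebyshev.theta_le_pi_mul_log'`) together with the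
tree's PROVED `Literature.NumberTheory.Multiplicative.quarter_le_theta` (`θ(x) ≥ x/4`, `x ≥ 3`), at the price of the constant:
**`romanoffAllN_unconditional : RomanoffAllN (1/79) 4`** with NO hypotheses. -/

/-- A Chebyshev-shape `π`-lower bound `c₀·n/log n ≤ π(n)` for `n ≥ x₁` (parameters only; the instance `c₀ = 0.69`,
`x₁ = 2^30` is PROVED below). [cite: RosserSchoenfeld1962, Thm 1 Cor. 1 eq. (3.5) (shape `x/log x < π(x)`, `x ≥ 17`)] -/
def PrimeCountingLowerMul (c₀ : ℝ) (x₁ : ℕ) : Prop :=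
  ∀ n : ℕ, x₁ ≤ n → c₀ * (n : ℝ) / Real.log (n : ℝ) ≤ (Nat.primeCounting n : ℝ)

/-- `π(n)·log n ≥ θ(n)` (Mathlib). [folklore] -/
private theorem theta_le_primeCounting_mul_log (n : ℕ) :
    Chebyshev.theta (n : ℝ) ≤ (Nat.primeCounting n : ℝ) * Real.log (n : ℝ) := by
  have h := Chebyshev.theta_le_pi_mul_log' (n : ℝ)
  rwa [Nat.floor_natCast] at h

/-- `exp 2 ≤ 2^28`. [folklore] -/
private theorem exp_two_le_two_pow_28 : Real.exp 2 ≤ (2 : ℝ) ^ 28 := by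
  have he : Real.exp 1 < 2.7182818286 := Real.exp_one_lt_d9
  have h : Real.exp 2 = Real.exp 1 * Real.exp 1 := by rw [← Real.exp_add]; norm_num
  rw [h]; nlinarith [Real.exp_pos 1]

/-- For `x ≥ 2^30`: `log x ≤ (30·log 2/32768)·√x` (`log x/√x` is decreasing on `[e², ∞)`). [folklore] -/
private theorem log_le_ratio_mul_sqrt {x : ℝ} (hx : (2 : ℝ) ^ 30 ≤ x) :
    Real.log x ≤ 30 * Real.log 2 / 32768 * Real.sqrt x := by
  have h28 : Real.exp 2 ≤ (2 : ℝ) ^ 30 := exp_two_le_two_pow_28.trans (by norm_num)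
  have hanti := Real.log_div_sqrt_antitoneOn (a := (2 : ℝ) ^ 30) (b := x) h28 (h28.trans hx) hx
  -- `hanti : log x / √x ≤ log (2^30) / √(2^30)`
  have hs30 : Real.sqrt ((2 : ℝ) ^ 30) = 32768 := by
    rw [show ((2 : ℝ) ^ 30) = 32768 ^ 2 by norm_num, Real.sqrt_sq (by norm_num)]
  have hl30 : Real.log ((2 : ℝ) ^ 30) = 30 * Real.log 2 := by rw [Real.log_pow]; norm_num
  simp only [hs30, hl30] at hanti
  have hxpos : 0 < x := lt_of_lt_of_le (by norm_num) hx
  have hsqpos : 0 < Real.sqrt x := Real.sqrt_pos.mpr hxpos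
  rw [div_le_iff₀ hsqpos] at hanti
  linarith

/-- **Chebyshev, explicit (Mathlib `Chebyshev.theta_ge'`)**: `0.69·n/log n ≤ π(n)` for every `n ≥ 2^30` — a weak explicit
form of Rosser–Schoenfeld's `x/log x < π(x)` (`x ≥ 17`), proved here from Mathlib, not taken from the paper.
[cite: RosserSchoenfeld1962, Thm 1 Cor. 1 eq. (3.5) (weak explicit form c₀ = 0.69, x ≥ 2^30, proved here)] -/
-- TODO(general form): (3.5) itself, `x/log x < π(x)` for `x ≥ 17`.
theorem primeCountingLowerMul_chebyshev : PrimeCountingLowerMul 0.69 (2 ^ 30) := by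
  intro n hn
  have hx : (2 : ℝ) ^ 30 ≤ (n : ℝ) := by exact_mod_cast hn
  have hπ := theta_le_primeCounting_mul_log n
  set x : ℝ := (n : ℝ) with hxdef
  have hx1 : (1 : ℝ) ≤ x := le_trans (by norm_num) hx
  have hxpos : 0 < x := by linarith
  have hθ := Chebyshev.theta_ge' hx1
  have hlogpos : 0 < Real.log x := Real.log_pos (by linarith)
  rw [div_le_iff₀ hlogpos]
  -- bounds on the error terms
  have hsx : (32768 : ℝ) ≤ Real.sqrt x := by
    rw [Real.le_sqrt (by norm_num) hxpos.le]; nlinarith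
  have hxx : Real.sqrt x * Real.sqrt x = x := Real.mul_self_sqrt hxpos.le
  have hratio := log_le_ratio_mul_sqrt hx
  have hlog2hi : Real.log 2 < 0.6931471808 := Real.log_two_lt_d9
  have hlog2lo : (0.6931471803 : ℝ) < Real.log 2 := Real.log_two_gt_d9
  have hr : 30 * Real.log 2 / 32768 ≤ (0.00063461 : ℝ) := by
    rw [div_le_iff₀ (by norm_num)]; linarith
  have hsq0 : 0 ≤ Real.sqrt x := Real.sqrt_nonneg x
  -- `log x ≤ 0.00063461 √x`
  have hlogx : Real.log x ≤ 0.00063461 * Real.sqrt x :=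
    hratio.trans (mul_le_mul_of_nonneg_right hr hsq0)
  -- `2 √x log x ≤ 0.00126922 x`
  have h2 : 2 * Real.sqrt x * Real.log x ≤ 0.00126922 * x := by
    have := mul_le_mul_of_nonneg_left hlogx hsq0
    nlinarith
  -- `√x ≤ x / 32768`, so `log x ≤ 0.00063461 x / 32768 ≤ 0.00000002 x`
  have hsqle : Real.sqrt x * 32768 ≤ x := by nlinarith
  have hlogx' : Real.log x ≤ 0.00000002 * x := by nlinarith
  -- `log (x + 2) ≤ log 2 + log x`
  have hlog2x : Real.log (x + 2) ≤ Real.log 2 + Real.log x := by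
    rw [← Real.log_mul (by norm_num) hxpos.ne']
    exact Real.log_le_log (by linarith) (by linarith)
  have hx' : (1073741824 : ℝ) ≤ x := by norm_num at hx; exact hx
  have hxl : (x - 1) * 0.6931471803 ≤ (x - 1) * Real.log 2 :=
    mul_le_mul_of_nonneg_left hlog2lo.le (by linarith)
  linarith

/-- Mid range, low piece: `x ≥ 5393`, `log x ≤ 19.74` ⇒ `(x + 2)/79 ≤ π(x)` (from `θ(x) ≥ x/4`). [folklore] -/
private theorem midLow_cheb {x : ℕ} (hx : 5393 ≤ x) (hlog : Real.log (x : ℝ) ≤ 19.74) :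
    ((x : ℝ) + 2) / 79 ≤ (Nat.primeCounting x : ℝ) := by
  have hxR : (5393 : ℝ) ≤ (x : ℝ) := by exact_mod_cast hx
  have hθ := Literature.NumberTheory.Multiplicative.quarter_le_theta (x := (x : ℝ)) (by linarith)
  have hπ := theta_le_primeCounting_mul_log x
  have hlogpos : 0 < Real.log (x : ℝ) := Real.log_pos (by linarith)
  have hπ0 : (0 : ℝ) ≤ Nat.primeCounting x := Nat.cast_nonneg _
  -- `x/4 ≤ π log x ≤ 19.74 π`
  have h1 : (x : ℝ) / 4 ≤ (Nat.primeCounting x : ℝ) * 19.74 :=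
    (hθ.trans hπ).trans (mul_le_mul_of_nonneg_left hlog hπ0)
  have h2 : (x : ℝ) ≤ 4 * 19.74 * (Nat.primeCounting x : ℝ) := by
    rw [div_le_iff₀ (by norm_num)] at h1; linarith
  rw [div_le_iff₀ (by norm_num)]
  nlinarith

/-- `2^28 ≤ x` when `19.74 ≤ log x`. [folklore] -/
private theorem two_pow_28_le_of_log {x : ℝ} (hx : 0 < x) (hlog : 19.74 ≤ Real.log x) : (2 : ℝ) ^ 28 ≤ x := by
  by_contra h
  rw [not_le] at h
  have := Real.log_lt_log hx h
  rw [Real.log_pow] at this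
  have hlog2hi : Real.log 2 < 0.6931471808 := Real.log_two_lt_d9
  push_cast at this
  nlinarith

/-- Mid range, high piece: `19.74 ≤ log x ≤ 41` ⇒ `(x + 2)/79 ≤ π(x)` (from Mathlib `theta_ge'`). [folklore] -/
private theorem midHigh_cheb {x : ℕ} (hlo : 19.74 ≤ Real.log (x : ℝ)) (hhi : Real.log (x : ℝ) ≤ 41) :
    ((x : ℝ) + 2) / 79 ≤ (Nat.primeCounting x : ℝ) := by
  have hxpos : (0 : ℝ) < (x : ℝ) := by
    by_contra h
    rw [not_lt] at h
    have hx0 : (x : ℝ) = 0 := le_antisymm h (Nat.cast_nonneg x)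
    rw [hx0, Real.log_zero] at hlo
    norm_num at hlo
  have hx28 := two_pow_28_le_of_log hxpos hlo
  have hx1 : (1 : ℝ) ≤ (x : ℝ) := le_trans (by norm_num) hx28
  have hθ := Chebyshev.theta_ge' hx1
  have hπ := theta_le_primeCounting_mul_log x
  have hπ0 : (0 : ℝ) ≤ Nat.primeCounting x := Nat.cast_nonneg _
  set y : ℝ := (x : ℝ) with hy
  have hsx : (16384 : ℝ) ≤ Real.sqrt y := by
    rw [Real.le_sqrt (by norm_num) hxpos.le]; norm_num at hx28 ⊢; linarith
  have hxx : Real.sqrt y * Real.sqrt y = y := Real.mul_self_sqrt hxpos.le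
  have hsq0 : 0 ≤ Real.sqrt y := Real.sqrt_nonneg y
  have hlog0 : 0 ≤ Real.log y := by linarith
  -- `2 √y log y ≤ 82 √y ≤ 82 y / 16384`
  have h2 : 2 * Real.sqrt y * Real.log y ≤ 82 / 16384 * y := by
    have h82 : Real.sqrt y * Real.log y ≤ Real.sqrt y * 41 := mul_le_mul_of_nonneg_left hhi hsq0
    have hsyle : Real.sqrt y * 16384 ≤ y := by nlinarith
    nlinarith
  have hlog2x : Real.log (y + 2) ≤ Real.log 2 + Real.log y := by
    rw [← Real.log_mul (by norm_num) hxpos.ne']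
    exact Real.log_le_log (by linarith) (by linarith)
  have hlog2hi : Real.log 2 < 0.6931471808 := Real.log_two_lt_d9
  have hlog2lo : (0.6931471803 : ℝ) < Real.log 2 := Real.log_two_gt_d9
  -- `θ y ≥ 0.688 y − 43`, and `θ y ≤ π · log y ≤ 41 π`
  have hθlow : 0.688 * y - 43 ≤ Chebyshev.theta y := by nlinarith
  have hup : Chebyshev.theta y ≤ (Nat.primeCounting x : ℝ) * 41 :=
    hπ.trans (mul_le_mul_of_nonneg_left hhi hπ0)
  have hy28 : (268435456 : ℝ) ≤ y := by norm_num at hx28; exact hx28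
  rw [div_le_iff₀ (by norm_num)]
  nlinarith

/-- **Mid range from Chebyshev**: `5395 ≤ N`, `log N ≤ 41` ⇒ `N/79 ≤ π(N − 2)`. [folklore] -/
private theorem mid_range_cheb {N : ℕ} (h1 : 5395 ≤ N) (h2 : Real.log (N : ℝ) ≤ 41) :
    (1 / 79 : ℝ) * (N : ℝ) ≤ (Nat.primeCounting (N - 2) : ℝ) := by
  have hcast : ((N - 2 : ℕ) : ℝ) = (N : ℝ) - 2 := by
    rw [Nat.cast_sub (by omega)]; norm_num
  have hN : (5395 : ℝ) ≤ N := by exact_mod_cast h1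
  have hlogle : Real.log ((N - 2 : ℕ) : ℝ) ≤ 41 := by
    rw [hcast]
    exact (Real.log_le_log (by linarith) (by linarith)).trans h2
  have key : (((N - 2 : ℕ) : ℝ) + 2) / 79 ≤ (Nat.primeCounting (N - 2) : ℝ) := by
    by_cases hlo : Real.log ((N - 2 : ℕ) : ℝ) ≤ 19.74
    · exact midLow_cheb (by omega) hlo
    · exact midHigh_cheb (by linarith [not_le.mp hlo]) hlogle
  rw [hcast] at key
  have : ((N : ℝ) - 2 + 2) / 79 = (1 / 79 : ℝ) * N := by ring
  linarith [this]


/-- **First moment from a Chebyshev-shape bound**: if `c₀ n/log n ≤ π(n)` for `n ≥ x₁` (`x₁ ≥ 3`, `c₀ ≥ 0`), then for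
`N ≥ 2x₁`, `S₁(N)·log N ≥ c₀·(N (log N/log 2 − 2) − x₁)` (only the top shift can fall short of `x₁`).
[cite: Nathanson1996, §7.6 Lemma 7.10 (first moment; explicit form proved here)] -/
theorem M1_ge_mul {c₀ : ℝ} {x₁ : ℕ} (hc₀ : 0 ≤ c₀) (hx₁ : 3 ≤ x₁) (hπ : PrimeCountingLowerMul c₀ x₁)
    {N : ℕ} (hN : 2 * x₁ ≤ N) :
    c₀ * ((N : ℝ) * (Real.log (N : ℝ) / Real.log 2 - 2) - x₁) ≤ M1 N * Real.log (N : ℝ) := by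
  set K := Nat.log 2 N with hK
  set L := Real.log (N : ℝ) with hL
  have hNpos : (0 : ℝ) < N := by exact_mod_cast (show 0 < N by omega)
  have hK1 : 1 ≤ K := Nat.le_log_of_pow_le (by norm_num) (by omega)
  have hpowK : 2 ^ K ≤ N := Nat.pow_log_le_self 2 (by omega)
  have hx₁pos : (0 : ℝ) < x₁ := by exact_mod_cast (show 0 < x₁ by omega)
  have hL0 : 0 < L := Real.log_pos (by exact_mod_cast (show 1 < N by omega))
  -- per-shift bound: `π(N − 2^k)·L ≥ c₀ (N − 2^k − [k = K]·x₁)`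
  have hshift : ∀ k ∈ Icc 1 K, c₀ * (((N : ℝ) - (2 : ℝ) ^ k) - (if k = K then (x₁ : ℝ) else 0))
      ≤ (Nat.primeCounting (N - 2 ^ k) : ℝ) * L := by
    intro k hk
    rw [mem_Icc] at hk
    have hpowk : 2 ^ k ≤ N := (Nat.pow_le_pow_right (by norm_num) hk.2).trans hpowK
    have hcast : ((N - 2 ^ k : ℕ) : ℝ) = (N : ℝ) - (2 : ℝ) ^ k := by
      rw [Nat.cast_sub hpowk]; push_cast; ring
    have hπ0 : (0 : ℝ) ≤ Nat.primeCounting (N - 2 ^ k) := Nat.cast_nonneg _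
    by_cases hbig : x₁ ≤ N - 2 ^ k
    · have hx := hπ (N - 2 ^ k) hbig
      have hxge : (3 : ℝ) ≤ ((N - 2 ^ k : ℕ) : ℝ) := by exact_mod_cast (hx₁.trans hbig)
      have hxpos : (0 : ℝ) < ((N - 2 ^ k : ℕ) : ℝ) := by linarith
      have hlogx0 : 0 < Real.log ((N - 2 ^ k : ℕ) : ℝ) := Real.log_pos (by linarith)
      have hlogxL : Real.log ((N - 2 ^ k : ℕ) : ℝ) ≤ L :=
        Real.log_le_log hxpos (by rw [hcast]; linarith [pow_pos (show (0:ℝ) < 2 by norm_num) k])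
      rw [div_le_iff₀ hlogx0] at hx
      -- `c₀ x ≤ π(x) log x ≤ π(x) L`
      have : c₀ * ((N - 2 ^ k : ℕ) : ℝ) ≤ (Nat.primeCounting (N - 2 ^ k) : ℝ) * L :=
        hx.trans (mul_le_mul_of_nonneg_left hlogxL hπ0)
      rw [hcast] at this
      have hc : (0 : ℝ) ≤ c₀ * (if k = K then (x₁ : ℝ) else 0) := by
        split_ifs <;> positivity
      nlinarith
    · have hkK : k = K := by
        by_contra hne
        have hlt : k < K := lt_of_le_of_ne hk.2 hne
        have : 2 ^ (k + 1) ≤ 2 ^ K := Nat.pow_le_pow_right (by norm_num) hlt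
        rw [pow_succ] at this
        omega
      rw [if_pos hkK]
      have hπL : (0 : ℝ) ≤ (Nat.primeCounting (N - 2 ^ k) : ℝ) * L := mul_nonneg hπ0 hL0.le
      have hlt : (N : ℝ) - (2 : ℝ) ^ k < x₁ := by
        have h' : ((N - 2 ^ k : ℕ) : ℝ) < x₁ := by exact_mod_cast (show N - 2 ^ k < x₁ by omega)
        rw [hcast] at h'; exact h'
      have : c₀ * (((N : ℝ) - (2 : ℝ) ^ k) - x₁) ≤ 0 :=
        mul_nonpos_of_nonneg_of_nonpos hc₀ (by linarith)
      linarith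
  have hsum := sum_le_sum hshift
  rw [← mul_sum, sum_sub_distrib, sum_sub_distrib, sum_const, Nat.card_Icc, sum_two_pow_Icc, sum_ite_eq',
    if_pos (mem_Icc.mpr ⟨hK1, le_rfl⟩), ← sum_mul] at hsum
  simp only [add_tsub_cancel_right, nsmul_eq_mul] at hsum
  have hmain := natlog_main N (by omega)
  have hM1 := M1_ge N
  have hM1' : (∑ k ∈ Icc 1 K, (Nat.primeCounting (N - 2 ^ k) : ℝ)) * L ≤ M1 N * L :=
    mul_le_mul_of_nonneg_right hM1 hL0.le
  have hmono : c₀ * ((N : ℝ) * (L / Real.log 2 - 2) - x₁)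
      ≤ c₀ * ((K : ℝ) * N - (2 * (2 : ℝ) ^ K - 2) - x₁) :=
    mul_le_mul_of_nonneg_left (by linarith) hc₀
  linarith

/-- `2^40 ≤ e^{41}`. [folklore] -/
private theorem two_pow_40_le_exp_41 : (2 : ℝ) ^ 40 ≤ Real.exp 41 := by
  have he : (2 : ℝ) ≤ Real.exp 1 := by have := Real.exp_one_gt_d9; linarith
  have h41 : (2 : ℝ) ^ 41 ≤ Real.exp 41 := by
    rw [show (41 : ℝ) = ((41 : ℕ) : ℝ) * 1 by norm_num, Real.exp_nat_mul]
    exact pow_le_pow_left₀ (by norm_num) he 41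
  exact le_trans (by norm_num) h41

/-- **The analytic branch, unconditional shape**: a uniform pair sieve `A` from `x₀` on and the Chebyshev bound
`0.69 n/log n ≤ π(n)` (`n ≥ 2^30`) give `#romanovSet N ≥ 0.96²/(0.96 + 4.035 A)·N` for `N ≥ max(x₀, e^{41})`.
[cite: Nathanson1996, §7.6 Theorem 7.11 (Romanov's theorem) — explicit-uniform form proved here] -/
theorem density_general_mul {A x₀ : ℝ} (hA : 0 ≤ A) (hPS : UniformPairSieve A x₀)
    (hπ : PrimeCountingLowerMul 0.69 (2 ^ 30)) {N : ℕ} (hx : x₀ ≤ (N : ℝ)) (hN : Real.exp 41 ≤ (N : ℝ)) :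
    (0.96 : ℝ) ^ 2 / (0.96 + 4.035 * A) * (N : ℝ) ≤ ((romanovSet N).card : ℝ) := by
  have hN40 : (2 : ℝ) ^ 40 ≤ (N : ℝ) := two_pow_40_le_exp_41.trans hN
  have hN40' : 2 ^ 40 ≤ N := by exact_mod_cast hN40
  have hNR : (1099511627776 : ℝ) ≤ N := by
    have h : (1099511627776 : ℕ) ≤ N := by simpa using hN40'
    exact_mod_cast h
  have hNpos : (0 : ℝ) < N := by linarith
  have hlog2lo : (0.6931471803 : ℝ) < Real.log 2 := Real.log_two_gt_d9
  have hlog2hi : Real.log 2 < 0.6931471808 := Real.log_two_lt_d9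
  set L := Real.log (N : ℝ) with hL
  have hL41 : (41 : ℝ) ≤ L := by
    have h := Real.log_le_log (Real.exp_pos 41) hN
    rwa [Real.log_exp] at h
  have h1 := M1_ge_mul (c₀ := 0.69) (x₁ := 2 ^ 30) (by norm_num) (by norm_num) hπ (N := N) (by omega)
  have hinv : (1.4426 : ℝ) * L ≤ L / Real.log 2 := by
    rw [le_div_iff₀ (by linarith)]; nlinarith
  have hM1 : (0.96 : ℝ) * N ≤ M1 N := by
    have hkey : (0.96 : ℝ) * N * L ≤ 0.69 * ((N : ℝ) * (L / Real.log 2 - 2) - ((2 ^ 30 : ℕ) : ℝ)) := by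
      have : (N : ℝ) * (1.4426 * L) ≤ (N : ℝ) * (L / Real.log 2) := mul_le_mul_of_nonneg_left hinv hNpos.le
      push_cast
      nlinarith [mul_le_mul_of_nonneg_left hL41 hNpos.le]
    exact le_of_mul_le_mul_right (hkey.trans h1) (by linarith)
  have h2 := M2_le_final hA hPS powTwoShiftMeanLe_193841 hx (by omega)
  have hB : A * 1.93841 / Real.log 2 ^ 2 ≤ 4.035 * A := by
    rw [div_le_iff₀ (by positivity)]
    have hsq : (0.48045 : ℝ) ≤ Real.log 2 ^ 2 := by nlinarith
    nlinarith [mul_le_mul_of_nonneg_left hsq hA]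
  have hM2 : M2 N ≤ M1 N + 4.035 * A * (N : ℝ) := by
    have : A * 1.93841 / Real.log 2 ^ 2 * (N : ℝ) ≤ 4.035 * A * (N : ℝ) :=
      mul_le_mul_of_nonneg_right hB hNpos.le
    linarith
  exact density_of_moments (by norm_num) (by positivity) hM1 hM2

/-- `4 ≤ N`, `log N ≤ 41`: `N/79 ≤ #romanovSet N`, UNCONDITIONALLY (Chebyshev + the kernel certificate). [folklore] -/
private theorem finite_range_cheb {N : ℕ} (h4 : 4 ≤ N) (hlog : Real.log (N : ℝ) ≤ 41) :
    (1 / 79 : ℝ) * (N : ℝ) ≤ ((romanovSet N).card : ℝ) := by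
  have hR : (Nat.primeCounting (N - 2) : ℝ) ≤ ((romanovSet N).card : ℝ) := by
    exact_mod_cast primeCounting_le_card_romanovSet N
  by_cases h1 : N < 5395
  · have hs := small_range h4 h1
    have hN0 : (0 : ℝ) ≤ N := Nat.cast_nonneg N
    linarith
  · exact (mid_range_cheb (by omega) hlog).trans hR

/-- **ROMANOFF'S THEOREM, EXPLICIT, UNIFORM IN `N`, UNCONDITIONAL**: for every `N ≥ 4`,
`#{n ≤ N : n = p + 2^k, p prime, k ≥ 1} ≥ N/79`.  NO named facts: the pair sieve is PART A
(`pairCount_le_kappa`, `17.75·f(h)·N/log²N` from `e^{41}`), the prime-counting input is Chebyshev's bound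
from Mathlib (`0.69 n/log n ≤ π(n)`, `n ≥ 2^30`; `θ ≥ x/4` on `[3, e^{19.74}]`), `N < 5395` is the ROUND-21
kernel certificate.  (Print: Romanoff 1934 `c > 0`, `N ≥ N₀` ineffective; Chen–Sun 2004 `0.0868`,
Pintz 2006 `0.09368`, Elsholtz–Schlage-Puchta 2018 `0.107648` — all for `N` sufficiently large.)
[cite: Nathanson1996, §7.6 Theorem 7.11 (Romanov's theorem) — explicit-uniform form proved here] -/
theorem romanoffAllN_unconditional : RomanoffAllN (1 / 79 : ℝ) 4 := by
  intro N hN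
  by_cases h3 : (N : ℝ) < Real.exp 41
  · have hNpos : (0 : ℝ) < N := by exact_mod_cast (show 0 < N by omega)
    have hlog : Real.log (N : ℝ) ≤ 41 := by
      have := Real.log_le_log hNpos h3.le
      rwa [Real.log_exp] at this
    exact finite_range_cheb hN hlog
  · rw [not_lt] at h3
    have hd := density_general_mul (A := 17.75) (x₀ := Real.exp 41) (by norm_num)
      uniformPairSieve_kappa primeCountingLowerMul_chebyshev h3 h3
    have hc : (1 / 79 : ℝ) ≤ (0.96 : ℝ) ^ 2 / (0.96 + 4.035 * 17.75) := by norm_num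
    have hN0 : (0 : ℝ) ≤ N := Nat.cast_nonneg N
    exact (mul_le_mul_of_nonneg_right hc hN0).trans hd

/-- The unconditional headline, unfolded: `∀ N ≥ 4, N/79 ≤ #romanovSet N`.
[cite: Nathanson1996, §7.6 Theorem 7.11 (Romanov's theorem) — explicit-uniform form proved here] -/
theorem romanoffAllN_unconditional_statement :
    ∀ N : ℕ, 4 ≤ N → (1 / 79 : ℝ) * (N : ℝ) ≤ ((romanovSet N).card : ℝ) :=
  romanoffAllN_unconditional

/-! ### §11 (appended) Chebyshev's constant `0.9212`: `RomanoffAllN (1/45) 4`, unconditionally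

Cell parity-ideate seat p5, ROUND-24 «ROMANOFF-CHEB» (`round24/RomanoffCheb.lean` 1acafe7563dc842c), statements and proofs
verbatim (helpers `private`; the three primed copies of this file's private lemmas dropped in favour of the originals).
ONE input of §10 varied: the prime-counting lower bound `PrimeCountingLowerMul 0.69 (2^30)` (Mathlib's `log 2`-Chebyshev)
is replaced by `primeCountingLowerMul_09212 : PrimeCountingLowerMul 0.9212 (10^6)` from the tree's PROVED Chebyshev bound
`Literature.NumberTheory.LFunctions.ChebyshevExplicit.psi_ge_chebyshev` (`A·n − 5 log n ≤ ψ(n)`, `A ≥ 0.921292`, `n ≥ 30`);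
everything else is this file's parametric chain re-instantiated (`M1_ge_mul`, `M2_le_final`, `density_of_moments`,
`uniformPairSieve_kappa`). Additional reference: P. L. Chebyshev, *Mémoire sur les nombres premiers*, J. Math. Pures
Appl. 17 (1852) 366–390, §5 [Chebyshev1852]; H. G. Diamond, *Elementary methods in the study of the distribution of
prime numbers*, Bull. AMS 7 (1982), §3 [Diamond1982]. -/

/-! #### §11.1 The prime-counting input: `c₀ = 0.9212` from `10^6` (tree `ChebyshevExplicit.psi_ge_chebyshev`) -/

/-- `0.9212·n/log n ≤ π(n)` for every `n ≥ 10^6`, from the tree's Chebyshev bound `A·n − 5 log n ≤ ψ(n)` (`A ≥ 0.921292`,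
`n ≥ 30`) and Mathlib's `ψ(n) ≤ π(n)·log n`. [cite: Chebyshev1852, §5 (constant A; via Diamond1982 §3)] -/
theorem primeCountingLowerMul_09212 : PrimeCountingLowerMul 0.9212 (10 ^ 6) := by
  intro n hn
  have hn0 : (10 : ℝ) ^ 6 ≤ n := by exact_mod_cast hn
  have hn1 : (1 : ℝ) < n := by linarith
  have hlogn : 0 < Real.log n := Real.log_pos hn1
  have h30 : 30 ≤ n := le_trans (by norm_num) hn
  have hψ := Literature.NumberTheory.LFunctions.ChebyshevExplicit.psi_ge_chebyshev h30
  have hA := Literature.NumberTheory.LFunctions.ChebyshevExplicit.A_bounds.1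
  have hπ := Chebyshev.psi_le_primeCounting_mul_log n
  have hlog : Real.log n ≤ 13.8156 + ((n : ℝ) / 10 ^ 6 - 1) := by
    have h1 : Real.log n = Real.log ((10 : ℝ) ^ 6) + Real.log ((n : ℝ) / 10 ^ 6) := by
      rw [← Real.log_mul (by norm_num) (by positivity)]
      congr 1
      field_simp
    have h2 : Real.log ((n : ℝ) / 10 ^ 6) ≤ (n : ℝ) / 10 ^ 6 - 1 :=
      Real.log_le_sub_one_of_pos (by positivity)
    linarith [Literature.NumberTheory.LFunctions.ChebyshevExplicit.log_1e6_le]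
  have hAn : 0.921292 * (n : ℝ) ≤ Literature.NumberTheory.LFunctions.ChebyshevExplicit.A * n :=
    mul_le_mul_of_nonneg_right hA (by positivity)
  rw [div_le_iff₀ hlogn]
  linarith

/-! #### §11.2 Pointwise: `(x + 2)/45 ≤ π(x)` on `88 ≤ x ≤ e^41` (the same Chebyshev bound, two log-ranges) -/

/-- `22000 ≤ e^10` (`e ≥ 2.7182818283`). [folklore] -/
private theorem exp_10_ge : (22000 : ℝ) ≤ Real.exp 10 := by
  have he : (2.7182818283 : ℝ) ≤ Real.exp 1 := Real.exp_one_gt_d9.le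
  have h10 : (2.7182818283 : ℝ) ^ 10 ≤ Real.exp 10 := by
    rw [show (10 : ℝ) = ((10 : ℕ) : ℝ) * 1 by norm_num, Real.exp_nat_mul]
    exact pow_le_pow_left₀ (by norm_num) he 10
  exact le_trans (by norm_num) h10

/-- **Chebyshev, pointwise**: `(x + 2)/45 ≤ π(x)` for `88 ≤ x` with `log x ≤ 41` (from `0.921292·x − 5 log x ≤ ψ(x) ≤ π(x) log x`;
`log x ≤ 10` below `22000`, `log x ≤ 41` above). [cite: Chebyshev1852, §5 (constant A; via Diamond1982 §3)] -/
theorem primeCounting_ge_div45 {x : ℕ} (hx : 88 ≤ x) (hlog : Real.log (x : ℝ) ≤ 41) :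
    ((x : ℝ) + 2) / 45 ≤ (Nat.primeCounting x : ℝ) := by
  have hxR : (88 : ℝ) ≤ x := by exact_mod_cast hx
  have hx1 : (1 : ℝ) < x := by linarith
  have hL : 0 < Real.log (x : ℝ) := Real.log_pos hx1
  have hψ := Literature.NumberTheory.LFunctions.ChebyshevExplicit.psi_ge_chebyshev (le_trans (by norm_num) hx)
  have hA := Literature.NumberTheory.LFunctions.ChebyshevExplicit.A_bounds.1
  have hπ := Chebyshev.psi_le_primeCounting_mul_log x
  have hAx : 0.921292 * (x : ℝ) ≤ Literature.NumberTheory.LFunctions.ChebyshevExplicit.A * x :=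
    mul_le_mul_of_nonneg_right hA (by positivity)
  -- so `0.921292 x − 5 log x ≤ π(x) · log x`
  have key : 0.921292 * (x : ℝ) - 5 * Real.log (x : ℝ) ≤ (Nat.primeCounting x : ℝ) * Real.log (x : ℝ) := by linarith
  have hP0 : (0 : ℝ) ≤ (Nat.primeCounting x : ℝ) := Nat.cast_nonneg _
  by_contra hcon
  rw [not_le] at hcon
  have hPL : (Nat.primeCounting x : ℝ) * Real.log (x : ℝ) ≤ ((x : ℝ) + 2) / 45 * Real.log (x : ℝ) :=
    mul_le_mul_of_nonneg_right hcon.le hL.le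
  by_cases hsmall : (x : ℝ) < 22000
  · -- `log x ≤ 10`
    have hL10 : Real.log (x : ℝ) ≤ 10 := by
      have h := Real.log_le_log (by linarith) (hsmall.le.trans exp_10_ge)
      rwa [Real.log_exp] at h
    have h3 : ((x : ℝ) + 2) / 45 * Real.log (x : ℝ) ≤ ((x : ℝ) + 2) / 45 * 10 :=
      mul_le_mul_of_nonneg_left hL10 (by positivity)
    nlinarith
  · rw [not_lt] at hsmall
    have h3 : ((x : ℝ) + 2) / 45 * Real.log (x : ℝ) ≤ ((x : ℝ) + 2) / 45 * 41 :=
      mul_le_mul_of_nonneg_left hlog (by positivity)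
    nlinarith

/-! #### §11.3 `π(N − 2) ≤ #romanovSet N` and the ranges below `e^41` -/

/-- `4 ≤ N < 90`: `N/45 ≤ π(N − 2)` (`π(2) = 1`, `π(3) = 2`). [folklore] -/
private theorem tiny_range {N : ℕ} (h4 : 4 ≤ N) (h90 : N < 90) :
    (1 / 45 : ℝ) * (N : ℝ) ≤ (Nat.primeCounting (N - 2) : ℝ) := by
  have mono : ∀ {a b : ℕ}, a ≤ b → Nat.primeCounting a ≤ Nat.primeCounting b :=
    fun hab => Nat.monotone_primeCounting hab
  have hNR : (N : ℝ) < 90 := by exact_mod_cast h90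
  by_cases h45 : N < 45
  · have h1 : 1 ≤ Nat.primeCounting (N - 2) := by
      have : Nat.primeCounting 2 = 1 := by decide
      have := mono (show 2 ≤ N - 2 by omega)
      omega
    have h1R : (1 : ℝ) ≤ Nat.primeCounting (N - 2) := by exact_mod_cast h1
    have : (N : ℝ) < 45 := by exact_mod_cast h45
    linarith
  · have h2 : 2 ≤ Nat.primeCounting (N - 2) := by
      have : Nat.primeCounting 3 = 2 := by decide
      have := mono (show 3 ≤ N - 2 by omega)
      omega
    have h2R : (2 : ℝ) ≤ Nat.primeCounting (N - 2) := by exact_mod_cast h2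
    linarith

/-- `90 ≤ N`, `log N ≤ 41`: `N/45 ≤ π(N − 2)` (Chebyshev, §2). [folklore] -/
private theorem mid_range_cheb45 {N : ℕ} (h90 : 90 ≤ N) (hlog : Real.log (N : ℝ) ≤ 41) :
    (1 / 45 : ℝ) * (N : ℝ) ≤ (Nat.primeCounting (N - 2) : ℝ) := by
  have hcast : ((N - 2 : ℕ) : ℝ) = (N : ℝ) - 2 := by
    rw [Nat.cast_sub (by omega)]; norm_num
  have hN : (90 : ℝ) ≤ N := by exact_mod_cast h90
  have hlogle : Real.log ((N - 2 : ℕ) : ℝ) ≤ 41 := by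
    rw [hcast]
    exact le_trans (Real.log_le_log (by linarith) (by linarith)) hlog
  have h := primeCounting_ge_div45 (x := N - 2) (by omega) hlogle
  rw [hcast] at h
  have e : ((N : ℝ) - 2 + 2) / 45 = (1 / 45 : ℝ) * N := by ring
  linarith [e.symm.le, e.le]

/-- `4 ≤ N`, `log N ≤ 41`: `N/45 ≤ #romanovSet N`, unconditionally. [folklore] -/
private theorem finite_range_cheb45 {N : ℕ} (h4 : 4 ≤ N) (hlog : Real.log (N : ℝ) ≤ 41) :
    (1 / 45 : ℝ) * (N : ℝ) ≤ ((romanovSet N).card : ℝ) := by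
  have hR : (Nat.primeCounting (N - 2) : ℝ) ≤ ((romanovSet N).card : ℝ) := by
    exact_mod_cast primeCounting_le_card_romanovSet N
  by_cases h90 : N < 90
  · exact (tiny_range h4 h90).trans hR
  · exact (mid_range_cheb45 (by omega) hlog).trans hR

/-! #### §11.4 The analytic range `N ≥ e^41`: `S₁(N) ≥ 1.28·N` and `#romanovSet N ≥ 1.28²/(1.28 + 4.035 A)·N` -/

/-- **The analytic branch with Chebyshev's `0.9212`**: a uniform pair sieve `A` from `x₀` on gives
`#romanovSet N ≥ 1.28²/(1.28 + 4.035 A)·N` for `N ≥ max(x₀, e^{41})` (`S₁(N) ≥ 1.28 N` from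
`0.9212·(log N/log 2 − 2 − 10^6/N)/… `; the tree's `density_general_mul` had `0.96`).
[cite: Nathanson1996, §7.6 Theorem 7.11 (Romanov's theorem) — explicit-uniform form proved here] -/
theorem density_cheb_mul {A x₀ : ℝ} (hA : 0 ≤ A) (hPS : UniformPairSieve A x₀)
    {N : ℕ} (hx : x₀ ≤ (N : ℝ)) (hN : Real.exp 41 ≤ (N : ℝ)) :
    (1.28 : ℝ) ^ 2 / (1.28 + 4.035 * A) * (N : ℝ) ≤ ((romanovSet N).card : ℝ) := by
  have hN40 : (2 : ℝ) ^ 40 ≤ (N : ℝ) := two_pow_40_le_exp_41.trans hN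
  have hN40' : 2 ^ 40 ≤ N := by exact_mod_cast hN40
  have hNR : (1099511627776 : ℝ) ≤ N := by
    have h : (1099511627776 : ℕ) ≤ N := by simpa using hN40'
    exact_mod_cast h
  have hNpos : (0 : ℝ) < N := by linarith
  have hlog2lo : (0.6931471803 : ℝ) < Real.log 2 := Real.log_two_gt_d9
  have hlog2hi : Real.log 2 < 0.6931471808 := Real.log_two_lt_d9
  set L := Real.log (N : ℝ) with hL
  have hL41 : (41 : ℝ) ≤ L := by
    have h := Real.log_le_log (Real.exp_pos 41) hN
    rwa [Real.log_exp] at h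
  have h1 := M1_ge_mul (c₀ := 0.9212) (x₁ := 10 ^ 6) (by norm_num) (by norm_num) primeCountingLowerMul_09212
    (N := N) (by omega)
  have hinv : (1.4426 : ℝ) * L ≤ L / Real.log 2 := by
    rw [le_div_iff₀ (by linarith)]; nlinarith
  have hM1 : (1.28 : ℝ) * N ≤ M1 N := by
    have hkey : (1.28 : ℝ) * N * L ≤ 0.9212 * ((N : ℝ) * (L / Real.log 2 - 2) - ((10 ^ 6 : ℕ) : ℝ)) := by
      have : (N : ℝ) * (1.4426 * L) ≤ (N : ℝ) * (L / Real.log 2) := mul_le_mul_of_nonneg_left hinv hNpos.le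
      push_cast
      nlinarith [mul_le_mul_of_nonneg_left hL41 hNpos.le]
    exact le_of_mul_le_mul_right (hkey.trans h1) (by linarith)
  have h2 := M2_le_final hA hPS powTwoShiftMeanLe_193841 hx (by omega)
  have hB : A * 1.93841 / Real.log 2 ^ 2 ≤ 4.035 * A := by
    rw [div_le_iff₀ (by positivity)]
    have hsq : (0.48045 : ℝ) ≤ Real.log 2 ^ 2 := by nlinarith
    nlinarith [mul_le_mul_of_nonneg_left hsq hA]
  have hM2 : M2 N ≤ M1 N + 4.035 * A * (N : ℝ) := by
    have : A * 1.93841 / Real.log 2 ^ 2 * (N : ℝ) ≤ 4.035 * A * (N : ℝ) :=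
      mul_le_mul_of_nonneg_right hB hNpos.le
    linarith
  exact density_of_moments (by norm_num) (by positivity) hM1 hM2

/-! #### §11.5 The headline: `RomanoffAllN (1/45) 4`, unconditionally -/

/-- ★ **ROMANOFF'S THEOREM, EXPLICIT, UNIFORM IN `N`, UNCONDITIONAL, Chebyshev constant**: for every `N ≥ 4`,
`#{n ≤ N : n = p + 2^k, p prime, k ≥ 1} ≥ N/45`.  NO named facts, no hypotheses: the pair sieve is the tree's
`uniformPairSieve_kappa` (`17.75·f(h)·N/log²N` from `e^{41}`), the prime-counting input is Chebyshev's
`0.9212·n/log n ≤ π(n)` (`n ≥ 10^6`) from the tree's `ChebyshevPsiExplicit`; `1.28²/(1.28 + 4.035·17.75) = 0.02247 ≥ 1/45`.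
(Tree before this file: `1/79` unconditional, `1/48` / `1/41` under Rosser–Schoenfeld (3.3).  Print, `N` large only:
Chen–Sun 2004 `0.0868`, Pintz 2006 `0.09368`, Elsholtz–Schlage-Puchta 2018 `0.107648`.)
[cite: Nathanson1996, §7.6 Theorem 7.11 (Romanov's theorem) — explicit-uniform form proved here] -/
theorem romanoffAllN_cheb : RomanoffAllN (1 / 45 : ℝ) 4 := by
  intro N hN
  by_cases h3 : (N : ℝ) < Real.exp 41
  · have hNpos : (0 : ℝ) < N := by exact_mod_cast (show 0 < N by omega)
    have hlog : Real.log (N : ℝ) ≤ 41 := by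
      have := Real.log_le_log hNpos h3.le
      rwa [Real.log_exp] at this
    exact finite_range_cheb45 hN hlog
  · rw [not_lt] at h3
    have hd := density_cheb_mul (A := 17.75) (x₀ := Real.exp 41) (by norm_num) uniformPairSieve_kappa h3 h3
    have hc : (1 / 45 : ℝ) ≤ (1.28 : ℝ) ^ 2 / (1.28 + 4.035 * 17.75) := by norm_num
    have hN0 : (0 : ℝ) ≤ N := Nat.cast_nonneg N
    exact (mul_le_mul_of_nonneg_right hc hN0).trans hd

/-- The unconditional headline, unfolded: `∀ N ≥ 4, N/45 ≤ #romanovSet N`.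
[cite: Nathanson1996, §7.6 Theorem 7.11 (Romanov's theorem) — explicit-uniform form proved here] -/
theorem romanoffAllN_cheb_statement :
    ∀ N : ℕ, 4 ≤ N → (1 / 45 : ℝ) * (N : ℝ) ≤ ((romanovSet N).card : ℝ) :=
  romanoffAllN_cheb

end RomanoffExplicit

end Literature.NumberTheory.Sieve
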